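import Literature.AlgebraicGeometry.Pohlmann1968.CMTypeRankCharactersNumberField
import Mathlib.RingTheory.RootsOfUnity.Complex
import HarnessLib

/-!
# Degenerate CM types of a cyclic CM field of degree `2pq` (Hazama 2003, Theorem 4.8) — group level

F. Hazama, *Hodge cycles on abelian varieties with complex multiplication by cyclic CM-fields*, J. Math. Sci.
Univ. Tokyo **10** (2003) 581–598 [Hazama2003CyclicCM] (held text `paper:w2141840783`, 18 pp., read in full;
page files p0001 = p. 581, …, p0018 = p. 598), classifies the CM types `S` of a CYCLIC CM field `K` of degree
`2pq`, `p ≠ q` odd primes, by the structure of the Hodge rings of the abelian varieties `A_S`: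

> "THEOREM 4.8 (p. 594). Let `p, q` be distinct odd primes. Let `CM` denote the set of CM-types for a cyclic galois
> CM-field of degree `2pq`. Let `Deg` denote the subset of `CM` consisting of degenerate CM-types, and `Prim`
> (resp. `NonPrim`) the subset of primitive (resp. nonprimitive) CM-types. […] for any divisor `d` of `2pq`, let
> `S_d = {S ∈ CM ; χ(S) = 0 for one (hence every) character of degree 2pq/(d, 2pq)}`. Then (i) `CM = Prim ∪ Nonprim`,
> (ii) `Deg = S₁ ∪ S_p ∪ S_q`, where `S_p ∩ S_q = {{2b}, {2b+1}} ⊂ S₁`, (iii) `Nonprim = S₁`, (iv) `Prim ∩ p-Dom =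
> S_p − S₁`, (v) `Prim ∩ q-Dom = S_q − S₁`, (vi) all the primitive and degenerate CM-types are 1-degenerate."

with the tools: Prop. 2.1 (Kubota/Ribet: "`dim A − rank H(A)` is equal to the number of the odd characters of `G`
such that `χ(S) = 0`" — the tree's `IsCMTypeWith.typeRank_eq_one_add_ncard_oddCharacters`), Prop. 2.3 ("`S` is
primitive if and only if it is not stable under any elements of `G − {g₁}`"), Prop. 4.1/(4.1) (the character sum
read on the odd-order part through `f_S = χ_S − χ_{ρS}`), Prop. 4.2 (`S_{pq} = ∅`: "`#(S)` is odd"), Prop. 4.3/4.4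
(`S_p` "↔ the `q × p` `(0,1)`-matrices with constant row sum", via (4.4)–(4.5)), Prop. 4.5, Prop. 4.6 with
**Lemma 4.6.1** ("A CM-type `S` belongs to `S₁` if and only if `S` is stable under the action of either `ℤ/2pℤ` or
`ℤ/2qℤ`", proved from Schoenberg's theorem (4.6) on the `ℤ`-relations among the `pq`-th roots of unity and the
`±1` analysis (4.9)–(4.10)), Prop. 4.7 (`S₁ ∩ S_p`), and §5 (for `S ∈ S_p − S₁` the odd kernel `K_S` is
`V_{2q} ∩ ℤ[ℤ/2nℤ]` with the basis `w_k^{(2q)}` of Prop. 3.2, "the weight of [the `F⁻¹(w_k)`] equal to `p` … the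
height of them equal to one", whence `p`-dominated and `1`-degenerate by [1, Prop. 2.4]).

## Setting and dictionary (group level, as in `CMTypeRankCharacters.lean` / `DegenerateCMTypesCompositeDimension.lean`)

`G` is a finite commutative group acting on itself, `Φ : Finset G` a CM type for the involution `ρ`
(`IsCMTypeWith ρ Φ`), characters are `AddChar (Additive G) ℂ`, the rank is the tree's `typeRank G Φ` (Kubota /
Dodson; `= dim MT`, nondegenerate iff `= n + 1`).  Hazama's cyclic group `ℤ/2nℤ`, `n = pq`, `ρ = n`, is presented by
a **frame** `CyclicFrame p q ρ τ κ`: `ρ² = 1 ≠ ρ`, `ord τ = p`, `ord κ = q`, `|G| = 2pq` — so that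
`G = ⟨ρ⟩ × ⟨τ⟩ × ⟨κ⟩ ≅ ℤ/2 × ℤ/p × ℤ/q ≅ ℤ/2pqℤ` (`coord_bijective`: every element is `τˣκʸ` or `ρτˣκʸ`), the
odd-order part `{τˣκʸ}` is Hazama's `{2b}` and carries the coordinates `(x, y) ∈ ℤ/p × ℤ/q` of (4.9)–(4.10)
(`ϕ : ℤ/p × ℤ/q → ℤ/pq`), `⟨τ⟩`, `⟨κ⟩` are the subgroups acting in Lemma 4.6.1, and
* `E(S)` ↦ `signMatrix p q Φ τ κ (x, y) = ±1` according as `τˣκʸ ∈ Φ` (Prop. 4.1);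
* an odd character `χ` "of degree `2q`" (resp. `2p`, `2pq`, `2`) ↦ `χ(ρ) = −1` and `χ(τ) = 1 ≠ χ(κ)` (resp.
  `χ(τ) ≠ 1 = χ(κ)`; `χ(τ) ≠ 1 ≠ χ(κ)`; `χ(τ) = χ(κ) = 1`); `χ(S)` ↦ `Σ_{s ∈ Φ} χ(s) = pairSum (E(S)) (χ τ) (χ κ)`;
* "`(0,1)`-matrix with constant row sum" ↦ `HasConstantRows p q Φ τ κ` (the counts `rowCount … y = #{x : τˣκʸ ∈ Φ}`
  do not depend on `y`); `S ∈ S_q` ↦ `HasConstantRows q p Φ κ τ` (the swapped frame `hF.swap`);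
* "stable under `ℤ/2pℤ`" ↦ `IsStableUnder Φ τ`; "primitive" ↦ no `u ≠ 1` with `IsStableUnder Φ u`
  (`exists_isStableUnder_iff_not_separating` = the tree's separation form of Shimura's primitivity);
* `w_k^{(2q)}` (height one, weight `p`) ↦ the subset `hazamaSet p ρ τ κ y₁ y₂ = {τˣκ^{y₁}} ∪ {ρτˣκ^{y₂}}`, a
  balanced weight (`IsBalanced`, Pohlmann's (9.2.1)) of cardinality `2p` which is not `ρ`-symmetric.

## What is PROVED (theorems; the definitions above have bodies; no named fact, no `sorry`)

* §1 `sum_mul_pow_eq_zero_iff_forall_eq` — a rational combination of the `q`-th roots of unity (`q` prime)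
  vanishes iff its coefficients are equal (`Φ_q` is the minimal polynomial); `sum_mul_pow_mul_eq_zero_of_coprime`
  — Galois conjugates `ζ ↦ ζᵃ` of a vanishing rational combination vanish ("one (hence every) character").
* §2 `pairSum_one_left_eq_zero_iff` / `…_right_…` (Prop. 4.3/4.4 in character form), `pairSum_pow_right_eq_zero`
  (conjugation `ν ↦ νᵇ`), **`pairSum_eq_zero_iff`** = LEMMA 4.6.1 in character form: for primitive `μ` (order
  `p`), `ν` (order `q`) and `ε = ±1`, `Σ ε(x,y) μˣνʸ = 0 ⟺ ε` does not depend on `x` or does not depend on `y`.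
  Schoenberg's (4.6) is replaced by what the proof uses of it: averaging the conjugates against `ν^{−by'}`
  (`sum_pow_mul_rowExcess_eq_zero`) and `Φ_p` irreducible give (4.10) in the form "`q ε(x,y') − Σ_y ε(x,y)` does not
  depend on `x`", and Hazama's `±1` analysis concludes.
* §3 the frame: `coord_bijective`, `exists_coord`, `pow_mul_pow_ne_rho_mul`, `pow_mul_pow_injective`;
  **`sum_char_eq_pairSum`** (Prop. 4.1); `sum_char_eq_zero_of_stable`; **`sum_char_ne_zero_of_trivial`** (Prop. 4.2).
* §4 **`sum_char_eq_zero_iff_hasConstantRows`** (Prop. 4.3) and `…_swap` (Prop. 4.4);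
  `forall_signMatrix_eq_left_iff` / `_right_iff` ((4.7)); **`sum_char_eq_zero_iff_isStableUnder`** (Lemma 4.6.1);
  **`exists_isStableUnder_iff`** (Prop. 2.3 / 4.6: a non-trivial stabiliser contains `τ` or `κ`);
  **`sum_char_eq_zero_iff_not_separating`** (Thm. 4.8 (iii) `Nonprim = S₁`);
  **`forall_mem_or_forall_not_mem_of_hasConstantRows`** + `isStableUnder_and_of_hasConstantRows` (Prop. 4.5:
  `S_p ∩ S_q = {S_even, S_odd} ⊂ S₁`); **`isStableUnder_right_iff`** (Prop. 4.7: `S₁ ∩ S_p` = the `κ`-stable types).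
* §5 `isBalanced_hazamaSet`, `card_hazamaSet`, `exists_mem_hazamaSet_rho_mul_not_mem` (the height-one weight-`p`
  kernel elements of §5); `typeRank_ne_of_hasConstantRows` (constant rows ⟹ degenerate, by this explicit Pohlmann
  witness and the tree's `symm_of_isBalanced_of_typeRank_eq`), `typeRank_ne_of_isStableUnder` (Kubota);
  **`typeRank_ne_iff`** / `typeRank_eq_iff` = THEOREM 4.8 (ii) (`Deg = S₁ ∪ S_p ∪ S_q`, through the tree's Kubota
  formula `IsCMTypeWith.typeRank_eq_iff_forall_oddCharacters`), **`typeRank_ne_iff_of_primitive`** = (ii)+(iii)+4.5: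
  the primitive degenerate types are `(S_p − S₁) ⊔ (S_q − S₁)` (Hazama's `p`- or `q`-dominated primitive types).
* §6 `exampleType` (Hazama's §6 matrix `a_{i1} = 1`), **`exists_primitive_hasConstantRows`** /
  **`exists_primitive_typeRank_ne`** — Rem. 4.9 at group level: EVERY cyclic group of order `2pq` carries primitive
  degenerate (`p`-dominated) CM types.
* §7 `oddChar_injOn`, `image_oddChar_eq` (odd characters `↔ μ_p × μ_q` via `χ ↦ (χ(τ), χ(κ))`, counting with the
  tree's `two_mul_ncard_oddCharacters_eq_card`), **`ncard_oddChar_vanishing_eq`** (the number of odd characters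
  vanishing on `S` is `(q−1)[S ∈ S_p] + (p−1)[S ∈ S_q] + (p−1)(q−1)[S ∈ S₁]`), **`typeRank_add_defect_eq`** (Prop. 2.1
  with Thm. 4.8: `rank(S) + defect = pq + 1`), **`typeRank_eq_of_primitive_of_hasConstantRows`** (a primitive
  `p`-dominated type has rank `(p−1)q + 2`, i.e. `dim Hg(A_S) = pq − (q − 1)`: the `q − 1` characters of order `2q`
  span the kernel, §5 "`K_S = V_{2q} ∩ ℤ[ℤ/2nℤ]`").

## NOT here

The notions "`N`-dominated" / "`h`-degenerate" themselves ([1] = Hazama, J. Alg. Geom. 9 (2000); [3]; Prop. 2.4 is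
cited there, not proved in the paper) — (iv)–(vi) are rendered by their combinatorial content (§5: explicit
height-one weight-`p` balanced subsets; §7: the kernel has rank `q − 1`); the counts `#S₁ = 2^p + 2^q − 2`,
`#S_p = Σ_i C(p,i)^q`, …; Schoenberg's theorem (4.6) as such; Rem. 4.11 (three primes).  The number-field / `ℚ(ζ_ℓ)` dress (Rem. 4.9–4.10, §6: `ℚ(ζ₃₁)`) is the companion
`AlgebraicGeometry/ComplexMultiplication/CyclotomicDegenerateCMTypesTwoOddPrimes.lean`.

Written for the COR-CM cell of the Hodge summit (`pub-hodgecm2`, literature seat Deligne 1982 continued / CM-type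
combinatorics, gen 18, claim HAZAMA-CYCLIC-2PQ).  Neighbours cited by name, nothing restated: `CMTypeRank.lean`
(`typeRank`, `IsCMTypeWith`, `IsBalanced`, Kubota's "nondegenerate ⟹ primitive"), `CMTypeRankCharacters.lean`
(Kubota's Lemma 2), `Pohlmann1968/CMTypeRankCharactersNumberField.lean` (`typeRank_eq_iff_forall_oddCharacters`),
`DegenerateCMTypesCompositeDimension.lean` (Dodson's `⟨ρ⟩ × ℤ/n`, the case `l ∣ n` arbitrary; here `n = pq` and ALL
types are classified).

## References

* [Hazama2003CyclicCM] F. Hazama, J. Math. Sci. Univ. Tokyo 10 (2003) 581–598: Prop. 2.1, 2.3 (p. 583), Prop. 3.1–3.2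
  (pp. 585–587), Prop. 4.1–4.7, Lemma 4.6.1, (4.1)–(4.12) (pp. 587–594), Thm. 4.8 (p. 594), Rem. 4.9–4.11 (p. 595),
  §5 (pp. 596–597).
* [Kubota1965] T. Kubota, Trans. AMS 118 (1965), §4 Lemma 2 (the character formula).
* [Gordon1999HodgeAVSurvey] B. B. Gordon, *A survey of the Hodge conjecture for abelian varieties*, §9.2 (9.2.1), §9.4.
-/

set_option autoImplicit false

noncomputable section

open scoped BigOperators
open Polynomial

namespace Literature.NumberTheory.ComplexMultiplication

namespace CyclicCMType

/-! ## §1 Rational linear relations among roots of unity -/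

section Roots

/-- Reindex a sum over `ZMod n` by the representatives `0, …, n − 1`. [folklore] -/
private theorem sum_zmod_eq_sum_range {M : Type*} [AddCommMonoid M] {n : ℕ} [NeZero n] (f : ℕ → M) :
    ∑ k : ZMod n, f k.val = ∑ k ∈ Finset.range n, f k := by
  refine Finset.sum_nbij' (fun k => k.val) (fun k => (k : ZMod n)) ?_ ?_ ?_ ?_ ?_
  · intro k _; exact Finset.mem_range.2 (ZMod.val_lt k)
  · intro k _; exact Finset.mem_univ _
  · intro k _; exact ZMod.natCast_zmod_val k
  · intro k hk; exact ZMod.val_cast_of_lt (Finset.mem_range.1 hk)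
  · intro k _; rfl

/-- `ωᵃ = ω^{a mod q}` when `ω^q = 1`. [folklore] -/
private theorem pow_eq_pow_mod_of_pow_eq_one {ω : ℂ} {q : ℕ} (h : ω ^ q = 1) (a : ℕ) :
    ω ^ a = ω ^ (a % q) := by
  conv_lhs => rw [← Nat.mod_add_div a q, pow_add, pow_mul, h, one_pow, mul_one]

/-- The rational polynomial `Σ_j m_j X^j` attached to a coefficient vector `m : ℤ/n → ℚ`. [folklore] -/
private def coeffPoly {n : ℕ} [NeZero n] (m : ZMod n → ℚ) : ℚ[X] := ∑ j : ZMod n, C (m j) * X ^ j.val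

/-- Evaluation of `Σ_j m_j X^j` at a complex number. [folklore] -/
private theorem aeval_coeffPoly {n : ℕ} [NeZero n] (m : ZMod n → ℚ) (z : ℂ) :
    aeval z (coeffPoly m) = ∑ j : ZMod n, (m j : ℂ) * z ^ j.val := by
  simp only [coeffPoly, map_sum, map_mul, aeval_C, map_pow, aeval_X, eq_ratCast]

/-- The `k`-th coefficient of `Σ_j m_j X^j` is `m_k` (`k < n`). [folklore] -/
private theorem coeff_coeffPoly {n : ℕ} [NeZero n] (m : ZMod n → ℚ) {k : ℕ} (hk : k < n) :
    (coeffPoly m).coeff k = m (k : ZMod n) := by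
  rw [coeffPoly, finsetSum_coeff]
  simp_rw [coeff_C_mul_X_pow]
  rw [Finset.sum_eq_single (k : ZMod n)]
  · rw [if_pos (ZMod.val_cast_of_lt hk).symm]
  · intro j _ hj
    rw [if_neg]
    intro h
    apply hj
    rw [h, ZMod.natCast_zmod_val]
  · intro h; exact absurd (Finset.mem_univ _) h

/-- `deg Σ_{j<n} m_j X^j < n`. [folklore] -/
private theorem natDegree_coeffPoly_lt {n : ℕ} [NeZero n] (m : ZMod n → ℚ) :
    (coeffPoly m).natDegree < n := by
  have hn := NeZero.pos n
  have h : (coeffPoly m).natDegree ≤ n - 1 := by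
    unfold coeffPoly
    refine natDegree_sum_le_of_forall_le _ _ fun j _ => ?_
    exact (natDegree_C_mul_X_pow_le (m j) j.val).trans (by have := ZMod.val_lt j; omega)
  omega

/-- **The only rational relation among the `q`-th roots of unity, `q` prime, is `Σ_j ν^j = 0`**: for a primitive
`q`-th root of unity `ν` and rational coefficients `m_j`, `Σ_{j ∈ ℤ/q} m_j ν^j = 0` iff all `m_j` are equal
(`Φ_q = 1 + X + ⋯ + X^{q−1}` is the minimal polynomial of `ν`).  Hazama uses this through Kubota/Ribet
("the rank of the Hodge matrix is related to the character sums"). [cite: Hazama2003CyclicCM, §2 Prop. 2.1 and §4 (4.1)] -/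
theorem sum_mul_pow_eq_zero_iff_forall_eq {q : ℕ} [hq : Fact q.Prime] {ν : ℂ} (hν : IsPrimitiveRoot ν q)
    (m : ZMod q → ℚ) :
    ∑ j : ZMod q, (m j : ℂ) * ν ^ j.val = 0 ↔ ∀ j j' : ZMod q, m j = m j' := by
  haveI : NeZero q := ⟨hq.out.ne_zero⟩
  have hq1 : 1 < q := hq.out.one_lt
  constructor
  · intro h
    have hdvd : cyclotomic q ℚ ∣ coeffPoly m := by
      rw [cyclotomic_eq_minpoly_rat hν hq.out.pos]
      exact minpoly.dvd ℚ ν (by rw [aeval_coeffPoly]; exact h)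
    obtain ⟨R, hR⟩ := hdvd
    have hdegΦ : (cyclotomic q ℚ).natDegree = q - 1 := by
      rw [natDegree_cyclotomic, Nat.totient_prime hq.out]
    obtain ⟨r, hr⟩ : ∃ r : ℚ, coeffPoly m = C r * cyclotomic q ℚ := by
      by_cases hR0 : R = 0
      · exact ⟨0, by rw [hR, hR0, mul_zero, map_zero, zero_mul]⟩
      · have hdeg := natDegree_coeffPoly_lt m
        rw [hR, natDegree_mul (cyclotomic_ne_zero q ℚ) hR0, hdegΦ] at hdeg
        have hR1 : R.natDegree = 0 := by omega
        refine ⟨R.coeff 0, ?_⟩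
        rw [hR, mul_comm, ← eq_C_of_natDegree_eq_zero hR1]
    have hcoef : ∀ k : ℕ, k < q → m (k : ZMod q) = r := by
      intro k hk
      rw [← coeff_coeffPoly m hk, hr, coeff_C_mul, cyclotomic_prime, finsetSum_coeff]
      simp_rw [coeff_X_pow]
      rw [Finset.sum_ite_eq, if_pos (Finset.mem_range.2 hk), mul_one]
    intro j j'
    rw [← ZMod.natCast_zmod_val j, ← ZMod.natCast_zmod_val j', hcoef _ (ZMod.val_lt j),
      hcoef _ (ZMod.val_lt j')]
  · intro h
    have hm : ∀ j, m j = m 0 := fun j => h j 0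
    simp_rw [hm]
    rw [← Finset.mul_sum, sum_zmod_eq_sum_range (fun k => ν ^ k), hν.geom_sum_eq_zero hq1, mul_zero]

/-- **Galois conjugates of a rational relation**: if `Σ_{k ∈ ℤ/n} c_k ζ^k = 0` for a primitive `n`-th root of
unity `ζ` and rational `c_k`, then `Σ_k c_k ζ^{ak} = 0` for every `a` prime to `n` (`Φ_n` divides
`Σ_k c_k X^k`, and `ζᵃ` is another root of `Φ_n`).  This is how Hazama passes from one character of a given
order to all of them ("`χ(S) = 0` for one (hence every) character of degree `2pq/(d, 2pq)`").
[cite: Hazama2003CyclicCM, Thm. 4.8 (definition of `S_d`)] -/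
theorem sum_mul_pow_mul_eq_zero_of_coprime {n : ℕ} [NeZero n] {ζ : ℂ} (hζ : IsPrimitiveRoot ζ n)
    (c : ZMod n → ℚ) (h0 : ∑ k : ZMod n, (c k : ℂ) * ζ ^ k.val = 0) {a : ℕ} (ha : a.Coprime n) :
    ∑ k : ZMod n, (c k : ℂ) * ζ ^ (a * k.val) = 0 := by
  have hn := NeZero.pos n
  have hdvd : minpoly ℚ ζ ∣ coeffPoly c := minpoly.dvd ℚ ζ (by rw [aeval_coeffPoly]; exact h0)
  have hζa : IsPrimitiveRoot (ζ ^ a) n := hζ.pow_of_coprime a ha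
  have hroot : aeval (ζ ^ a) (minpoly ℚ ζ) = 0 := by
    rw [← cyclotomic_eq_minpoly_rat hζ hn, aeval_def, ← eval_map, map_cyclotomic, ← IsRoot.def,
      isRoot_cyclotomic_iff]
    exact hζa
  have := aeval_eq_zero_of_dvd_aeval_eq_zero hdvd hroot
  rw [aeval_coeffPoly] at this
  simpa only [← pow_mul] using this

end Roots

/-! ## §2 Hazama's character sums in the coordinates `ℤ/p × ℤ/q` of the odd part -/

section Pair

variable {p q : ℕ}

/-- **The character sum of a `±1`-matrix** `ε` on `ℤ/p × ℤ/q` at a pair of roots of unity `(μ, ν)`: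
`V(ε; μ, ν) = Σ_{x,y} ε(x,y) μˣ νʸ`.  For a CM type `S` of the cyclic group `⟨ρ⟩ × ⟨τ⟩ × ⟨κ⟩` of order `2pq`,
`ε(x,y) = ±1` according as `τˣκʸ ∈ S`, and `χ(S) = V(ε; χ(τ), χ(κ))` for every ODD character `χ` (Hazama's (4.1):
"`χ(S) = Σ_{0 ≤ a ≤ n−1} f_S(a) χ(a)`", `f_S = χ_S − χ_{ρS}`, written in the coordinates `a ↔ (a mod p, a mod q)`).
[cite: Hazama2003CyclicCM, §4 (4.1) and Prop. 4.1] -/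
def pairSum [NeZero p] [NeZero q] (ε : ZMod p × ZMod q → ℤ) (μ ν : ℂ) : ℂ :=
  ∑ xy : ZMod p × ZMod q, (ε xy : ℂ) * (μ ^ xy.1.val * ν ^ xy.2.val)

/-- **Prop. 4.3/4.4, character form.**  For a primitive `q`-th root of unity `ν` (an odd character trivial on
`⟨τ⟩` and non-trivial on `⟨κ⟩`, i.e. of order `2q`): `V(ε; 1, ν) = 0` iff the ROW SUMS `Σ_x ε(x,y)` do not
depend on `y` — "the equations (4.4) are equivalent to the condition (4.5) that `#{a ∈ R_i ; e_a = 1}` does not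
depend on `i`". [cite: Hazama2003CyclicCM, Prop. 4.3 (proof, (4.4)–(4.5))] -/
theorem pairSum_one_left_eq_zero_iff [NeZero p] [hq : Fact q.Prime] {ν : ℂ} (hν : IsPrimitiveRoot ν q)
    (ε : ZMod p × ZMod q → ℤ) :
    haveI : NeZero q := ⟨hq.out.ne_zero⟩
    pairSum ε 1 ν = 0 ↔ ∀ y y' : ZMod q, ∑ x : ZMod p, ε (x, y) = ∑ x : ZMod p, ε (x, y') := by
  haveI : NeZero q := ⟨hq.out.ne_zero⟩
  have key : pairSum ε 1 ν =
      ∑ y : ZMod q, (((∑ x : ZMod p, ε (x, y) : ℤ) : ℚ) : ℂ) * ν ^ y.val := by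
    unfold pairSum
    rw [Fintype.sum_prod_type_right]
    refine Fintype.sum_congr _ _ fun y => ?_
    push_cast
    rw [Finset.sum_mul]
    refine Fintype.sum_congr _ _ fun x => ?_
    rw [one_pow, one_mul]
  rw [key, sum_mul_pow_eq_zero_iff_forall_eq hν]
  simp only [Int.cast_inj]

/-- **Prop. 4.4 (the symmetric statement), character form.**  For a primitive `p`-th root of unity `μ`:
`V(ε; μ, 1) = 0` iff the COLUMN SUMS `Σ_y ε(x,y)` do not depend on `x`. [cite: Hazama2003CyclicCM, Prop. 4.4] -/
theorem pairSum_one_right_eq_zero_iff [hp : Fact p.Prime] [NeZero q] {μ : ℂ} (hμ : IsPrimitiveRoot μ p)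
    (ε : ZMod p × ZMod q → ℤ) :
    haveI : NeZero p := ⟨hp.out.ne_zero⟩
    pairSum ε μ 1 = 0 ↔ ∀ x x' : ZMod p, ∑ y : ZMod q, ε (x, y) = ∑ y : ZMod q, ε (x', y) := by
  haveI : NeZero p := ⟨hp.out.ne_zero⟩
  have key : pairSum ε μ 1 =
      ∑ x : ZMod p, (((∑ y : ZMod q, ε (x, y) : ℤ) : ℚ) : ℂ) * μ ^ x.val := by
    unfold pairSum
    rw [Fintype.sum_prod_type]
    refine Fintype.sum_congr _ _ fun x => ?_
    push_cast
    rw [Finset.sum_mul]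
    refine Fintype.sum_congr _ _ fun y => ?_
    rw [one_pow, mul_one]
  rw [key, sum_mul_pow_eq_zero_iff_forall_eq hμ]
  simp only [Int.cast_inj]

/-- A product of primitive roots of unity of coprime orders `p`, `q` is a primitive `pq`-th root of unity. [folklore] -/
private theorem isPrimitiveRoot_mul {μ ν : ℂ} (hμ : IsPrimitiveRoot μ p) (hν : IsPrimitiveRoot ν q)
    (hco : p.Coprime q) : IsPrimitiveRoot (μ * ν) (p * q) := by
  rw [IsPrimitiveRoot.iff_orderOf, (Commute.all μ ν).orderOf_mul_eq_mul_orderOf_of_coprime]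
  · rw [← hμ.eq_orderOf, ← hν.eq_orderOf]
  · rwa [← hμ.eq_orderOf, ← hν.eq_orderOf]

/-- The coordinates of `ZMod.chineseRemainder`: `k ↦ (k mod p, k mod q)`. [folklore] -/
private theorem chineseRemainder_apply [NeZero p] [NeZero q] (hco : p.Coprime q) (k : ZMod (p * q)) :
    ZMod.chineseRemainder hco k = ((k.val : ZMod p), (k.val : ZMod q)) := by
  haveI : NeZero (p * q) := ⟨mul_ne_zero (NeZero.ne p) (NeZero.ne q)⟩
  have h : ZMod.chineseRemainder hco k = (ZMod.cast k : ZMod p × ZMod q) := rfl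
  rw [h, ZMod.cast_eq_val]
  ext <;> simp

/-- **Change of coordinates `ℤ/pq ≅ ℤ/p × ℤ/q`** in a sum against powers of `μν` (`μ^p = 1`, `ν^q = 1`):
`Σ_{k ∈ ℤ/pq} ε(k mod p, k mod q) (μν)^k = V(ε; μ, ν)`. [folklore] -/
private theorem sum_zmod_mul_eq_pairSum [NeZero p] [NeZero q] (hco : p.Coprime q)
    (ε : ZMod p × ZMod q → ℤ) {μ ν : ℂ} (hμ : μ ^ p = 1) (hν : ν ^ q = 1) :
    ∑ k : ZMod (p * q), (ε (ZMod.chineseRemainder hco k) : ℂ) * (μ * ν) ^ k.val = pairSum ε μ ν := by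
  unfold pairSum
  rw [← (ZMod.chineseRemainder hco).toEquiv.sum_comp]
  refine Fintype.sum_congr _ _ fun k => ?_
  have h := chineseRemainder_apply hco k
  simp only [RingEquiv.toEquiv_eq_coe, EquivLike.coe_coe]
  rw [h, mul_pow, ZMod.val_natCast, ZMod.val_natCast, ← pow_eq_pow_mod_of_pow_eq_one hμ,
    ← pow_eq_pow_mod_of_pow_eq_one hν]

/-- **Galois conjugation in the `κ`-variable**: if `V(ε; μ, ν) = 0` for primitive roots `μ` (order `p`) and `ν`
(order `q`), `p ≠ q` primes, then `V(ε; μ, νᵇ) = 0` for every `b ≢ 0 (mod q)` (conjugate by the automorphism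
`ζ_{pq} ↦ ζ_{pq}ᵃ`, `a ≡ 1 (p)`, `a ≡ b (q)`). [cite: Hazama2003CyclicCM, Thm. 4.8 ("one (hence every) character")] -/
theorem pairSum_pow_right_eq_zero [hp : Fact p.Prime] [hq : Fact q.Prime] (hpq : p ≠ q) {μ ν : ℂ}
    (hμ : IsPrimitiveRoot μ p) (hν : IsPrimitiveRoot ν q) (ε : ZMod p × ZMod q → ℤ)
    (h0 : haveI : NeZero p := ⟨hp.out.ne_zero⟩; haveI : NeZero q := ⟨hq.out.ne_zero⟩; pairSum ε μ ν = 0)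
    {b : ZMod q} (hb : b ≠ 0) :
    haveI : NeZero p := ⟨hp.out.ne_zero⟩
    haveI : NeZero q := ⟨hq.out.ne_zero⟩
    pairSum ε μ (ν ^ b.val) = 0 := by
  haveI : NeZero p := ⟨hp.out.ne_zero⟩
  haveI : NeZero q := ⟨hq.out.ne_zero⟩
  haveI : NeZero (p * q) := ⟨mul_ne_zero (NeZero.ne p) (NeZero.ne q)⟩
  have hco : p.Coprime q := (Nat.coprime_primes hp.out hq.out).2 hpq
  obtain ⟨a, ha1, hab⟩ := Nat.chineseRemainder hco 1 b.val
  have hbpos : b.val ≠ 0 := by rwa [ne_eq, ZMod.val_eq_zero]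
  have hacop : a.Coprime (p * q) := by
    refine Nat.Coprime.mul_right ?_ ?_
    · rw [Nat.Coprime, ha1.gcd_eq, Nat.gcd_one_left]
    · rw [Nat.Coprime, hab.gcd_eq]
      exact (Nat.coprime_of_lt_prime hbpos (ZMod.val_lt b) hq.out).symm
  have hζ := isPrimitiveRoot_mul hμ hν hco
  set c : ZMod (p * q) → ℚ := fun k => (ε (ZMod.chineseRemainder hco k) : ℚ) with hc_def
  have hc : ∀ k, (c k : ℂ) = (ε (ZMod.chineseRemainder hco k) : ℂ) := fun k => by
    rw [hc_def]; push_cast; rfl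
  have hc0 : ∑ k : ZMod (p * q), (c k : ℂ) * (μ * ν) ^ k.val = 0 := by
    simp_rw [hc]
    rw [sum_zmod_mul_eq_pairSum hco ε hμ.pow_eq_one hν.pow_eq_one]
    exact h0
  have h1 := sum_mul_pow_mul_eq_zero_of_coprime hζ c hc0 hacop
  have hμa : μ ^ a = μ := by
    rw [pow_eq_pow_mod_of_pow_eq_one hμ.pow_eq_one, show a % p = 1 % p from ha1,
      Nat.mod_eq_of_lt hp.out.one_lt, pow_one]
  have hνa : ν ^ a = ν ^ b.val := by
    rw [pow_eq_pow_mod_of_pow_eq_one hν.pow_eq_one, show a % q = b.val % q from hab,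
      Nat.mod_eq_of_lt (ZMod.val_lt b)]
  have hνb : (ν ^ b.val) ^ q = 1 := by
    rw [← pow_mul, mul_comm, pow_mul, hν.pow_eq_one, one_pow]
  have hprod : (μ * ν) ^ a = μ * ν ^ b.val := by rw [mul_pow, hμa, hνa]
  have h2 : ∑ k : ZMod (p * q), (c k : ℂ) * (μ * ν) ^ (a * k.val) = pairSum ε μ (ν ^ b.val) := by
    simp_rw [pow_mul, hprod, hc]
    exact sum_zmod_mul_eq_pairSum hco ε hμ.pow_eq_one hνb
  rwa [h2] at h1

/-- **The Ramanujan sum over the non-trivial `q`-th roots** (`q` prime, `ν` primitive): for `t ∈ ℤ/q`,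
`Σ_{b ≠ 0} (νᵇ)ᵗ = q − 1` if `t = 0` and `= −1` otherwise. [folklore] -/
private theorem sum_erase_zero_pow_pow [hq : Fact q.Prime] {ν : ℂ} (hν : IsPrimitiveRoot ν q) (t : ZMod q) :
    haveI : NeZero q := ⟨hq.out.ne_zero⟩
    ∑ b ∈ (Finset.univ : Finset (ZMod q)).erase 0, (ν ^ b.val) ^ t.val =
      if t = 0 then (q : ℂ) - 1 else -1 := by
  haveI : NeZero q := ⟨hq.out.ne_zero⟩
  have hfull : ∑ b : ZMod q, (ν ^ b.val) ^ t.val = if t = 0 then (q : ℂ) else 0 := by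
    have hre : ∀ b : ZMod q, (ν ^ b.val) ^ t.val = (ν ^ t.val) ^ b.val := fun b => by
      rw [← pow_mul, ← pow_mul, mul_comm]
    simp_rw [hre]
    rw [sum_zmod_eq_sum_range (fun k => (ν ^ t.val) ^ k)]
    by_cases ht : t = 0
    · rw [if_pos ht, ht, ZMod.val_zero, pow_zero]
      simp
    · rw [if_neg ht]
      have htv : t.val ≠ 0 := by rwa [ne_eq, ZMod.val_eq_zero]
      have hω : IsPrimitiveRoot (ν ^ t.val) q :=
        hν.pow_of_coprime t.val (Nat.coprime_of_lt_prime htv (ZMod.val_lt t) hq.out).symm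
      exact hω.geom_sum_eq_zero hq.out.one_lt
  rw [← Finset.sum_erase_add _ _ (Finset.mem_univ (0 : ZMod q)), ZMod.val_zero, pow_zero,
    one_pow] at hfull
  split_ifs at hfull ⊢
  · linear_combination hfull
  · linear_combination hfull

/-- **Averaging the conjugates** (the step from (4.6)/(4.9) to (4.10), done with characters): if
`V(ε; μ, νᵇ) = 0` for all `b ≢ 0`, then for every column index `y'`,
`Σ_x μˣ (q·ε(x,y') − Σ_y ε(x,y)) = 0`. [cite: Hazama2003CyclicCM, Lemma 4.6.1 (proof)] -/
private theorem sum_pow_mul_rowExcess_eq_zero [hp : Fact p.Prime] [hq : Fact q.Prime] (hpq : p ≠ q)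
    {μ ν : ℂ} (hμ : IsPrimitiveRoot μ p) (hν : IsPrimitiveRoot ν q) (ε : ZMod p × ZMod q → ℤ)
    (h0 : haveI : NeZero p := ⟨hp.out.ne_zero⟩; haveI : NeZero q := ⟨hq.out.ne_zero⟩; pairSum ε μ ν = 0)
    (y' : ZMod q) :
    haveI : NeZero p := ⟨hp.out.ne_zero⟩
    haveI : NeZero q := ⟨hq.out.ne_zero⟩
    ∑ x : ZMod p, μ ^ x.val * ((q : ℂ) * ε (x, y') - ∑ y : ZMod q, (ε (x, y) : ℂ)) = 0 := by
  haveI : NeZero p := ⟨hp.out.ne_zero⟩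
  haveI : NeZero q := ⟨hq.out.ne_zero⟩
  set B : Finset (ZMod q) := (Finset.univ : Finset (ZMod q)).erase 0 with hB
  have hvan : ∑ b ∈ B, (ν ^ b.val) ^ (-y').val * pairSum ε μ (ν ^ b.val) = 0 := by
    refine Finset.sum_eq_zero fun b hb => ?_
    rw [pairSum_pow_right_eq_zero hpq hμ hν ε h0 (Finset.ne_of_mem_erase hb), mul_zero]
  -- the powers of `νᵇ` reduce modulo `q`
  have hsplit : ∀ (b : ZMod q) (y : ZMod q),
      (ν ^ b.val) ^ (y - y').val = (ν ^ b.val) ^ y.val * (ν ^ b.val) ^ (-y').val := by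
    intro b y
    have hbq : (ν ^ b.val) ^ q = 1 := by rw [← pow_mul, mul_comm, pow_mul, hν.pow_eq_one, one_pow]
    rw [sub_eq_add_neg, ZMod.val_add, ← pow_eq_pow_mod_of_pow_eq_one hbq, pow_add]
  -- the inner row identity
  have hrow : ∀ x : ZMod p,
      μ ^ x.val * ((q : ℂ) * ε (x, y') - ∑ y : ZMod q, (ε (x, y) : ℂ)) =
        ∑ y : ZMod q, (ε (x, y) : ℂ) * μ ^ x.val *
          ∑ b ∈ B, (ν ^ b.val) ^ y.val * (ν ^ b.val) ^ (-y').val := by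
    intro x
    have h1 : ∀ y : ZMod q, ∑ b ∈ B, (ν ^ b.val) ^ y.val * (ν ^ b.val) ^ (-y').val =
        (if y = y' then (q : ℂ) else 0) - 1 := by
      intro y
      simp_rw [← hsplit]
      rw [hB, sum_erase_zero_pow_pow hν (y - y')]
      by_cases hy : y = y'
      · simp [hy]
      · simp [hy, sub_eq_zero]
    simp_rw [h1, mul_sub, mul_one, Finset.sum_sub_distrib, mul_ite, mul_zero]
    rw [Finset.sum_ite_eq' Finset.univ y', if_pos (Finset.mem_univ _), Finset.mul_sum]
    ring
  rw [Finset.sum_congr rfl fun x _ => hrow x, ← hvan]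
  -- rearrange the triple sum
  have hR : ∀ b : ZMod q, (ν ^ b.val) ^ (-y').val * pairSum ε μ (ν ^ b.val) =
      ∑ x : ZMod p, ∑ y : ZMod q,
        (ε (x, y) : ℂ) * μ ^ x.val * ((ν ^ b.val) ^ y.val * (ν ^ b.val) ^ (-y').val) := by
    intro b
    unfold pairSum
    rw [Fintype.sum_prod_type, Finset.mul_sum]
    refine Finset.sum_congr rfl fun x _ => ?_
    rw [Finset.mul_sum]
    refine Finset.sum_congr rfl fun y _ => ?_
    ring
  simp_rw [hR, Finset.mul_sum]
  calc ∑ x : ZMod p, ∑ y : ZMod q, ∑ b ∈ B,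
          (ε (x, y) : ℂ) * μ ^ x.val * ((ν ^ b.val) ^ y.val * (ν ^ b.val) ^ (-y').val)
      = ∑ x : ZMod p, ∑ b ∈ B, ∑ y : ZMod q,
          (ε (x, y) : ℂ) * μ ^ x.val * ((ν ^ b.val) ^ y.val * (ν ^ b.val) ^ (-y').val) :=
        Finset.sum_congr rfl fun x _ => Finset.sum_comm
    _ = ∑ b ∈ B, ∑ x : ZMod p, ∑ y : ZMod q,
          (ε (x, y) : ℂ) * μ ^ x.val * ((ν ^ b.val) ^ y.val * (ν ^ b.val) ^ (-y').val) := Finset.sum_comm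

/-- **Lemma 4.6.1, character form (the heart of Theorem 4.8).**  For primitive roots of unity `μ` (order `p`)
and `ν` (order `q`), `p ≠ q` primes, and a `±1`-matrix `ε` on `ℤ/p × ℤ/q`:
`V(ε; μ, ν) = Σ_{x,y} ε(x,y) μˣνʸ = 0` iff `ε(x,y)` does not depend on `x` or does not depend on `y` — "if
`(c₀, …, c_{pq−1}) ∈ T_{pq}` [a `±1`-vector killed by `ζ_{pq}`] then it is stable under the action of either
`ℤ/pℤ` or `ℤ/qℤ`" ((4.8)).  Hazama derives it from Schoenberg's description (4.6) of the `ℤ`-relations among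
the `pq`-th roots of unity; here (4.6) is replaced by its consequence actually used: averaging the Galois
conjugates `V(ε; μ, νᵇ) = 0` (`b ≢ 0`) against `ν^{−by'}` gives `Σ_x μˣ(q ε(x,y') − Σ_y ε(x,y)) = 0`, so by the
irreducibility of `Φ_p` the integers `q ε(x,y') − Σ_y ε(x,y)` do not depend on `x` — which is (4.10)
`a_i + b_j ∈ {0,1}` in additive form — and the `±1` analysis of (4.9)–(4.10) concludes.
[cite: Hazama2003CyclicCM, Lemma 4.6.1 and (4.6)–(4.10)] -/
theorem pairSum_eq_zero_iff [hp : Fact p.Prime] [hq : Fact q.Prime] (hpq : p ≠ q) {μ ν : ℂ}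
    (hμ : IsPrimitiveRoot μ p) (hν : IsPrimitiveRoot ν q) (ε : ZMod p × ZMod q → ℤ)
    (hε : ∀ xy, ε xy = 1 ∨ ε xy = -1) :
    haveI : NeZero p := ⟨hp.out.ne_zero⟩
    haveI : NeZero q := ⟨hq.out.ne_zero⟩
    pairSum ε μ ν = 0 ↔
      (∀ (x x' : ZMod p) (y : ZMod q), ε (x, y) = ε (x', y)) ∨
        (∀ (x : ZMod p) (y y' : ZMod q), ε (x, y) = ε (x, y')) := by
  haveI : NeZero p := ⟨hp.out.ne_zero⟩
  haveI : NeZero q := ⟨hq.out.ne_zero⟩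
  have hμsum : ∑ x : ZMod p, μ ^ x.val = 0 := by
    rw [sum_zmod_eq_sum_range (fun k => μ ^ k), hμ.geom_sum_eq_zero hp.out.one_lt]
  have hνsum : ∑ y : ZMod q, ν ^ y.val = 0 := by
    rw [sum_zmod_eq_sum_range (fun k => ν ^ k), hν.geom_sum_eq_zero hq.out.one_lt]
  constructor
  · intro h0
    -- (4.10): `q ε(x,y') − Σ_y ε(x,y)` does not depend on `x`
    have hconst : ∀ (y' : ZMod q) (x x' : ZMod p),
        (q : ℤ) * ε (x, y') - ∑ y, ε (x, y) = (q : ℤ) * ε (x', y') - ∑ y, ε (x', y) := by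
      intro y'
      have h := sum_pow_mul_rowExcess_eq_zero hpq hμ hν ε h0 y'
      have h' : ∑ x : ZMod p, ((((q : ℤ) * ε (x, y') - ∑ y, ε (x, y) : ℤ) : ℚ) : ℂ) * μ ^ x.val = 0 := by
        rw [← h]
        refine Fintype.sum_congr _ _ fun x => ?_
        push_cast
        ring
      have := (sum_mul_pow_eq_zero_iff_forall_eq hμ _).1 h'
      intro x x'
      exact_mod_cast this x x'
    have hq0 : (q : ℤ) ≠ 0 := by exact_mod_cast hq.out.ne_zero
    have key : ∀ (x x' : ZMod p) (y y' : ZMod q), ε (x, y) - ε (x', y) = ε (x, y') - ε (x', y') := by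
      intro x x' y y'
      have h1 := hconst y x x'
      have h2 := hconst y' x x'
      have : (q : ℤ) * (ε (x, y) - ε (x', y)) = (q : ℤ) * (ε (x, y') - ε (x', y')) := by linarith
      exact mul_left_cancel₀ hq0 this
    by_cases H : ∀ (x x' : ZMod p) (y : ZMod q), ε (x, y) = ε (x', y)
    · exact Or.inl H
    · right
      push Not at H
      obtain ⟨x₁, x₂, y₁, hne⟩ := H
      intro x y y'
      have e1 := hε (x₁, y₁); have e2 := hε (x₂, y₁); have e3 := hε (x₂, y); have e4 := hε (x₂, y')
      have e5 := hε (x₁, y); have e6 := hε (x₁, y'); have e7 := hε (x, y); have e8 := hε (x, y')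
      have k1 := key x₁ x₂ y₁ y; have k2 := key x₁ x₂ y₁ y'; have k3 := key x x₂ y y'
      omega
  · rintro (H | H)
    · -- `ε(x,y) = ε(0,y)`: the sum factors through `Σ_x μˣ = 0`
      unfold pairSum
      rw [Fintype.sum_prod_type_right]
      refine Finset.sum_eq_zero fun y _ => ?_
      have : ∀ x : ZMod p, (ε (x, y) : ℂ) * (μ ^ x.val * ν ^ y.val) = (ε (0, y) : ℂ) * ν ^ y.val * μ ^ x.val :=
        fun x => by rw [H x 0 y]; ring
      rw [Fintype.sum_congr _ _ this, ← Finset.mul_sum, hμsum, mul_zero]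
    · unfold pairSum
      rw [Fintype.sum_prod_type]
      refine Finset.sum_eq_zero fun x _ => ?_
      have : ∀ y : ZMod q, (ε (x, y) : ℂ) * (μ ^ x.val * ν ^ y.val) = (ε (x, 0) : ℂ) * μ ^ x.val * ν ^ y.val :=
        fun y => by rw [H x y 0]; ring
      rw [Fintype.sum_congr _ _ this, ← Finset.mul_sum, hνsum, mul_zero]

end Pair

/-! ## §3 The group `G = ⟨ρ⟩ × ⟨τ⟩ × ⟨κ⟩` of order `2pq` and its CM types -/

section Sign

variable {G : Type*} [DecidableEq G]

/-- **Hazama's sign function of a type**: `f_S(g) = 1` if `g ∈ S`, `−1` otherwise (on the odd part this is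
`χ_S − χ_{ρS}`). [cite: Hazama2003CyclicCM, §4 (before (4.1))] -/
def typeSign (Φ : Finset G) (g : G) : ℤ := if g ∈ Φ then 1 else -1

/-- `f_S(g) = ±1`. [cite: Hazama2003CyclicCM, §4 (before (4.1))] -/
theorem typeSign_eq_or (Φ : Finset G) (g : G) : typeSign Φ g = 1 ∨ typeSign Φ g = -1 := by
  unfold typeSign; split_ifs <;> simp

/-- `f_S(g) = 1 ↔ g ∈ S`. [cite: Hazama2003CyclicCM, §4 (before (4.1))] -/
theorem typeSign_eq_one_iff (Φ : Finset G) (g : G) : typeSign Φ g = 1 ↔ g ∈ Φ := by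
  unfold typeSign; split_ifs with h <;> simp [h]

/-- `f_S(g) = f_S(g') ↔ (g ∈ S ↔ g' ∈ S)`. [cite: Hazama2003CyclicCM, §4 (before (4.1))] -/
theorem typeSign_eq_typeSign_iff (Φ : Finset G) (g g' : G) :
    typeSign Φ g = typeSign Φ g' ↔ (g ∈ Φ ↔ g' ∈ Φ) := by
  unfold typeSign
  by_cases h : g ∈ Φ <;> by_cases h' : g' ∈ Φ <;> simp [h, h']

end Sign

section Frame

variable {G : Type*} [CommGroup G] [Fintype G]

omit [Fintype G] in
/-- `χ(gh) = χ(g)χ(h)`. [folklore] -/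
private theorem char_mul (χ : AddChar (Additive G) ℂ) (g h : G) :
    χ (Additive.ofMul (g * h)) = χ (Additive.ofMul g) * χ (Additive.ofMul h) := by
  rw [ofMul_mul, AddChar.map_add_eq_mul]

omit [Fintype G] in
/-- `χ(gᵉ) = χ(g)ᵉ`. [folklore] -/
private theorem char_pow (χ : AddChar (Additive G) ℂ) (g : G) (e : ℕ) :
    χ (Additive.ofMul (g ^ e)) = χ (Additive.ofMul g) ^ e := by
  rw [ofMul_pow, AddChar.map_nsmul_eq_pow]

/-- **A frame `(ρ, τ, κ)` of orders `(2, p, q)`** for a finite commutative group of order `2pq`, `p ≠ q` odd primes: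
`G = ⟨ρ⟩ × ⟨τ⟩ × ⟨κ⟩ ≅ ℤ/2pqℤ` is then cyclic, `ρ` is its complex conjugation ("`ρ` corresponds to `n ∈ ℤ/2nℤ`",
`n = pq`), `⟨τ⟩` and `⟨κ⟩` are its subgroups of order `p` and `q` (Hazama's "`ℤ/2pℤ`- and `ℤ/2qℤ`-actions" on
types), and `(x, y) ↦ τˣκʸ` are the coordinates `ℤ/pq ≅ ℤ/p × ℤ/q` of the odd-order part used in (4.9)–(4.10).
[cite: Hazama2003CyclicCM, §3–§4 (the group `ℤ/2nℤ`, `n = pq`)] -/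
structure CyclicFrame (p q : ℕ) (ρ τ κ : G) : Prop where
  prime_left : p.Prime
  prime_right : q.Prime
  ne : p ≠ q
  left_ne_two : p ≠ 2
  right_ne_two : q ≠ 2
  rho_ne_one : ρ ≠ 1
  rho_mul_rho : ρ * ρ = 1
  orderOf_tau : orderOf τ = p
  orderOf_kappa : orderOf κ = q
  card_eq : Fintype.card G = 2 * (p * q)

namespace CyclicFrame

variable {p q : ℕ} {ρ τ κ : G} (hF : CyclicFrame p q ρ τ κ)
include hF

/-- The frame with the roles of `p, τ` and `q, κ` exchanged. [cite: Hazama2003CyclicCM, Prop. 4.4 ("by symmetry")] -/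
theorem swap : CyclicFrame q p ρ κ τ where
  prime_left := hF.prime_right
  prime_right := hF.prime_left
  ne := hF.ne.symm
  left_ne_two := hF.right_ne_two
  right_ne_two := hF.left_ne_two
  rho_ne_one := hF.rho_ne_one
  rho_mul_rho := hF.rho_mul_rho
  orderOf_tau := hF.orderOf_kappa
  orderOf_kappa := hF.orderOf_tau
  card_eq := by rw [hF.card_eq, mul_comm p q]

/-- `p` and `q` are coprime. [cite: Hazama2003CyclicCM, §4 ("distinct odd primes")] -/
theorem coprime : p.Coprime q := (Nat.coprime_primes hF.prime_left hF.prime_right).2 hF.ne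

/-- `pq` is odd. [cite: Hazama2003CyclicCM, §4 ("distinct odd primes")] -/
theorem odd_mul : Odd (p * q) :=
  (hF.prime_left.odd_of_ne_two hF.left_ne_two).mul (hF.prime_right.odd_of_ne_two hF.right_ne_two)

/-- `τ^p = 1`. [cite: Hazama2003CyclicCM, §4] -/
theorem tau_pow : τ ^ p = 1 := by rw [← hF.orderOf_tau]; exact pow_orderOf_eq_one τ

/-- `κ^q = 1`. [cite: Hazama2003CyclicCM, §4] -/
theorem kappa_pow : κ ^ q = 1 := by rw [← hF.orderOf_kappa]; exact pow_orderOf_eq_one κ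

/-- `ρ^{pq} = ρ` (`pq` odd). [cite: Hazama2003CyclicCM, §4] -/
theorem rho_pow_mul : ρ ^ (p * q) = ρ := by
  obtain ⟨m, hm⟩ := hF.odd_mul
  rw [hm, pow_succ, pow_mul, sq, hF.rho_mul_rho, one_pow, one_mul]

/-- `(τᵃκᵇ)^{pq} = 1`: the elements `τᵃκᵇ` form the odd-order part. [cite: Hazama2003CyclicCM, §4] -/
theorem pow_mul_pow_pow_mul (a b : ℕ) : (τ ^ a * κ ^ b) ^ (p * q) = 1 := by
  have h1 : τ ^ (a * (p * q)) = 1 := by rw [mul_left_comm, pow_mul, hF.tau_pow, one_pow]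
  have h2 : κ ^ (b * (p * q)) = 1 := by rw [mul_comm p q, mul_left_comm, pow_mul, hF.kappa_pow, one_pow]
  rw [mul_pow, ← pow_mul, ← pow_mul, h1, h2, one_mul]

/-- `ρ` is not in the odd-order part: `τᵃκᵇ ≠ ρ·τᶜκᵈ`. [cite: Hazama2003CyclicCM, §4] -/
theorem pow_mul_pow_ne_rho_mul (a b c d : ℕ) : τ ^ a * κ ^ b ≠ ρ * (τ ^ c * κ ^ d) := by
  intro h
  have h1 := congrArg (fun g : G => g ^ (p * q)) h
  have h2 : (τ ^ a * κ ^ b) ^ (p * q) = (ρ * (τ ^ c * κ ^ d)) ^ (p * q) := h1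
  rw [hF.pow_mul_pow_pow_mul, mul_pow, hF.pow_mul_pow_pow_mul, hF.rho_pow_mul, mul_one] at h2
  exact hF.rho_ne_one h2.symm

/-- `τˣκʸ = τˣ'κʸ'` only if `(x, y) = (x', y')` (`x, x' ∈ ℤ/p`, `y, y' ∈ ℤ/q`). [cite: Hazama2003CyclicCM, §4 (the map `ϕ`)] -/
theorem pow_mul_pow_injective :
    Function.Injective fun xy : ZMod p × ZMod q => τ ^ xy.1.val * κ ^ xy.2.val := by
  haveI : NeZero p := ⟨hF.prime_left.ne_zero⟩
  haveI : NeZero q := ⟨hF.prime_right.ne_zero⟩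
  rintro ⟨x, y⟩ ⟨x', y'⟩ h
  have h' : τ ^ x.val * κ ^ y.val = τ ^ x'.val * κ ^ y'.val := h
  -- raise to the power `q` to isolate `τ`, to the power `p` to isolate `κ`
  have e1 : ∀ (z : ZMod p) (w : ZMod q), (τ ^ z.val * κ ^ w.val) ^ q = τ ^ (q * z.val) := fun z w => by
    rw [mul_pow, ← pow_mul, ← pow_mul, mul_comm z.val, mul_comm w.val, pow_mul κ q, hF.kappa_pow,
      one_pow, mul_one]
  have e2 : ∀ (z : ZMod p) (w : ZMod q), (τ ^ z.val * κ ^ w.val) ^ p = κ ^ (p * w.val) := fun z w => by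
    rw [mul_pow, ← pow_mul, ← pow_mul, mul_comm z.val, mul_comm w.val, pow_mul τ p, hF.tau_pow,
      one_pow, one_mul]
  have hx : τ ^ (q * x.val) = τ ^ (q * x'.val) := by rw [← e1 x y, ← e1 x' y', h']
  have hy : κ ^ (p * y.val) = κ ^ (p * y'.val) := by rw [← e2 x y, ← e2 x' y', h']
  rw [pow_eq_pow_iff_modEq, hF.orderOf_tau] at hx
  rw [pow_eq_pow_iff_modEq, hF.orderOf_kappa] at hy
  have hx' := Nat.ModEq.cancel_left_of_coprime hF.coprime hx
  have hy' := Nat.ModEq.cancel_left_of_coprime hF.coprime.symm hy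
  have ex : x.val = x'.val := Nat.ModEq.eq_of_lt_of_lt hx' (ZMod.val_lt x) (ZMod.val_lt x')
  have ey : y.val = y'.val := Nat.ModEq.eq_of_lt_of_lt hy' (ZMod.val_lt y) (ZMod.val_lt y')
  exact Prod.ext (ZMod.val_injective p ex) (ZMod.val_injective q ey)

/-- **The coordinates of `G`**: `(x, y) ↦ τˣκʸ` together with `(x, y) ↦ ρτˣκʸ` is a bijection
`(ℤ/p × ℤ/q) ⊔ (ℤ/p × ℤ/q) → G` (Hazama's identification of the cyclic group of order `2n`, `n = pq`, with
`ℤ/2nℤ`, `ρ = n`, the odd part being `ℤ/nℤ ≅ ℤ/p × ℤ/q`). [cite: Hazama2003CyclicCM, §4] -/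
theorem coord_bijective :
    Function.Bijective fun s : (ZMod p × ZMod q) ⊕ (ZMod p × ZMod q) =>
      Sum.elim (fun xy => τ ^ xy.1.val * κ ^ xy.2.val) (fun xy => ρ * (τ ^ xy.1.val * κ ^ xy.2.val)) s := by
  haveI : NeZero p := ⟨hF.prime_left.ne_zero⟩
  haveI : NeZero q := ⟨hF.prime_right.ne_zero⟩
  rw [Fintype.bijective_iff_injective_and_card]
  refine ⟨?_, by rw [Fintype.card_sum, Fintype.card_prod, ZMod.card, ZMod.card, hF.card_eq, two_mul]⟩
  rintro (a | a) (b | b) hab <;> simp only [Sum.elim_inl, Sum.elim_inr] at hab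
  · exact congrArg Sum.inl (hF.pow_mul_pow_injective hab)
  · exact absurd hab (hF.pow_mul_pow_ne_rho_mul _ _ _ _)
  · exact absurd hab.symm (hF.pow_mul_pow_ne_rho_mul _ _ _ _)
  · exact congrArg Sum.inr (hF.pow_mul_pow_injective (mul_left_cancel hab))

/-- Every `g ∈ G` is `τˣκʸ` or `ρτˣκʸ`. [cite: Hazama2003CyclicCM, §4] -/
theorem exists_coord (g : G) :
    ∃ xy : ZMod p × ZMod q, g = τ ^ xy.1.val * κ ^ xy.2.val ∨ g = ρ * (τ ^ xy.1.val * κ ^ xy.2.val) := by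
  obtain ⟨s, h⟩ := hF.coord_bijective.2 g
  rcases s with xy | xy
  · exact ⟨xy, Or.inl (by simpa using h.symm)⟩
  · exact ⟨xy, Or.inr (by simpa using h.symm)⟩

/-- `τ^{(x + x').val} = τ^{x.val} τ^{x'.val}`: the exponents of `τ` live in `ℤ/p` (Hazama's indices "regarded as
elements of `ℤ/pqℤ`", here split as `ℤ/p × ℤ/q`). [cite: Hazama2003CyclicCM, Lemma 4.6.1 (proof, the actions of `ℤ/pℤ`, `ℤ/qℤ`)] -/
theorem tau_pow_val_add (x x' : ZMod p) : τ ^ (x + x').val = τ ^ x.val * τ ^ x'.val := by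
  haveI : NeZero p := ⟨hF.prime_left.ne_zero⟩
  have h := pow_mod_orderOf τ (x.val + x'.val)
  rw [hF.orderOf_tau] at h
  rw [ZMod.val_add, h, pow_add]

/-- `κ^{(y + y').val} = κ^{y.val} κ^{y'.val}`: the exponents of `κ` live in `ℤ/q`. [cite: Hazama2003CyclicCM, Lemma 4.6.1 (proof, the actions of `ℤ/pℤ`, `ℤ/qℤ`)] -/
theorem kappa_pow_val_add (y y' : ZMod q) : κ ^ (y + y').val = κ ^ y.val * κ ^ y'.val := by
  haveI : NeZero q := ⟨hF.prime_right.ne_zero⟩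
  have h := pow_mod_orderOf κ (y.val + y'.val)
  rw [hF.orderOf_kappa] at h
  rw [ZMod.val_add, h, pow_add]

/-- `τ^{(1 : ℤ/p).val} = τ` (the generator `i = 1` of the `ℤ/pℤ`-action). [cite: Hazama2003CyclicCM, Lemma 4.6.1 (proof)] -/
theorem tau_pow_val_one : τ ^ (1 : ZMod p).val = τ := by
  haveI : Fact (1 < p) := ⟨hF.prime_left.one_lt⟩
  rw [ZMod.val_one, pow_one]

/-- `κ^{(1 : ℤ/q).val} = κ` (the generator of the `ℤ/qℤ`-action). [cite: Hazama2003CyclicCM, Lemma 4.6.1 (proof)] -/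
theorem kappa_pow_val_one : κ ^ (1 : ZMod q).val = κ := by
  haveI : Fact (1 < q) := ⟨hF.prime_right.one_lt⟩
  rw [ZMod.val_one, pow_one]

end CyclicFrame

end Frame

/-! ### Hazama's matrix `E(S)` of a type and its row counts -/

section Matrix

variable {G : Type*} [CommGroup G] [DecidableEq G]

/-- **Hazama's `±1`-function `E(S)` of a type in coordinates**: `E(S)(x, y) = f_S(τˣκʸ) = ±1` according as
`τˣκʸ ∈ S` (Prop. 4.1: "The correspondence `S → E(S)` gives a bijection between the set of CM-types for
`ℤ/2nℤ` and the set of `{±1}`-valued functions on `ℤ/nℤ`", here `ℤ/nℤ ≅ ℤ/p × ℤ/q`).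
[cite: Hazama2003CyclicCM, Prop. 4.1] -/
def signMatrix (p q : ℕ) (Φ : Finset G) (τ κ : G) : ZMod p × ZMod q → ℤ :=
  fun xy => typeSign Φ (τ ^ xy.1.val * κ ^ xy.2.val)

/-- **The row counts** `#{x : τˣκʸ ∈ S}` of the `(0,1)`-matrix `(z_{ij})` of a type (rows indexed by `y ∈ ℤ/q`,
`p` entries each): Prop. 4.3's "`q × p` `(0,1)`-matrices with constant row sum". [cite: Hazama2003CyclicCM, Prop. 4.3] -/
def rowCount (p q : ℕ) [NeZero p] (Φ : Finset G) (τ κ : G) (y : ZMod q) : ℕ :=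
  (Finset.univ.filter fun x : ZMod p => τ ^ x.val * κ ^ y.val ∈ Φ).card

/-- `E(S)(x,y) = ±1`. [cite: Hazama2003CyclicCM, Prop. 4.1] -/
theorem signMatrix_eq_or (p q : ℕ) (Φ : Finset G) (τ κ : G) (xy : ZMod p × ZMod q) :
    signMatrix p q Φ τ κ xy = 1 ∨ signMatrix p q Φ τ κ xy = -1 :=
  typeSign_eq_or Φ _

/-- `E(S)(x,y) = 1 ↔ τˣκʸ ∈ S`. [cite: Hazama2003CyclicCM, Prop. 4.1] -/
theorem signMatrix_eq_one_iff (p q : ℕ) (Φ : Finset G) (τ κ : G) (xy : ZMod p × ZMod q) :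
    signMatrix p q Φ τ κ xy = 1 ↔ τ ^ xy.1.val * κ ^ xy.2.val ∈ Φ :=
  typeSign_eq_one_iff Φ _

/-- **Row sums of `E(S)` are `2·(row count) − p`**. [cite: Hazama2003CyclicCM, Prop. 4.3 (proof)] -/
theorem sum_signMatrix_row (p q : ℕ) [NeZero p] (Φ : Finset G) (τ κ : G) (y : ZMod q) :
    ∑ x : ZMod p, signMatrix p q Φ τ κ (x, y) = 2 * (rowCount p q Φ τ κ y : ℤ) - p := by
  unfold signMatrix typeSign rowCount
  have h : ∀ x : ZMod p, (if τ ^ x.val * κ ^ y.val ∈ Φ then (1 : ℤ) else -1) =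
      2 * (if τ ^ x.val * κ ^ y.val ∈ Φ then (1 : ℤ) else 0) - 1 := fun x => by
    split_ifs <;> norm_num
  simp only
  simp_rw [h]
  rw [Finset.sum_sub_distrib, ← Finset.mul_sum, Finset.sum_boole, Finset.sum_const, Finset.card_univ,
    ZMod.card]
  simp

/-- Row sums of `E(S)` are constant iff the row counts are. [cite: Hazama2003CyclicCM, Prop. 4.3 (proof)] -/
theorem forall_sum_signMatrix_row_eq_iff (p q : ℕ) [NeZero p] (Φ : Finset G) (τ κ : G) :
    (∀ y y' : ZMod q, ∑ x : ZMod p, signMatrix p q Φ τ κ (x, y) = ∑ x : ZMod p, signMatrix p q Φ τ κ (x, y')) ↔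
      ∀ y y' : ZMod q, rowCount p q Φ τ κ y = rowCount p q Φ τ κ y' := by
  simp_rw [sum_signMatrix_row]
  constructor
  · intro h y y'; have := h y y'; omega
  · intro h y y'; rw [h y y']

/-- The matrix of the swapped frame is the transpose: `E(S)^{κ,τ}(y, x) = E(S)^{τ,κ}(x, y)`. [cite: Hazama2003CyclicCM, Prop. 4.4] -/
theorem signMatrix_swap (p q : ℕ) (Φ : Finset G) (τ κ : G) (x : ZMod p) (y : ZMod q) :
    signMatrix q p Φ κ τ (y, x) = signMatrix p q Φ τ κ (x, y) := by
  unfold signMatrix; rw [mul_comm]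

end Matrix

/-! ### The character sum of a type in coordinates (Prop. 4.1) -/

section CharacterSum

variable {G : Type*} [CommGroup G] [Fintype G] [DecidableEq G] {p q : ℕ} {ρ τ κ : G} {Φ : Finset G}

omit [Fintype G] [DecidableEq G] in
/-- For a CM type `S` (for `ρ`): `ρg ∈ S ↔ g ∉ S`. [cite: Hazama2003CyclicCM, §4 ("`S ∩ ρS = ∅`")] -/
theorem rho_mul_mem_iff (h : IsCMTypeWith ρ (Φ : Set G)) (g : G) : ρ * g ∈ Φ ↔ g ∉ Φ := by
  have := h.mem_iff g
  rw [Finset.mem_coe, smul_eq_mul, Finset.mem_coe] at this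
  tauto

/-- **Prop. 4.1: the character sum of a type in coordinates.**  For an ODD character `χ` (`χ(ρ) = −1`) of
`G = ⟨ρ⟩ × ⟨τ⟩ × ⟨κ⟩` and a CM type `S`: `χ(S) = Σ_{s∈S} χ(s) = Σ_{x,y} E(S)(x,y) χ(τ)ˣ χ(κ)ʸ = V(E(S); χ(τ), χ(κ))`
("`χ(S) = Σ_{0≤a≤n−1} f_S(a)χ(a)`", (4.1)). [cite: Hazama2003CyclicCM, Prop. 4.1 and (4.1)] -/
theorem sum_char_eq_pairSum (hF : CyclicFrame p q ρ τ κ) (h : IsCMTypeWith ρ (Φ : Set G))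
    (χ : AddChar (Additive G) ℂ) (hχ : χ (Additive.ofMul ρ) = -1) :
    haveI : NeZero p := ⟨hF.prime_left.ne_zero⟩
    haveI : NeZero q := ⟨hF.prime_right.ne_zero⟩
    ∑ s ∈ Φ, χ (Additive.ofMul s) =
      pairSum (signMatrix p q Φ τ κ) (χ (Additive.ofMul τ)) (χ (Additive.ofMul κ)) := by
  haveI : NeZero p := ⟨hF.prime_left.ne_zero⟩
  haveI : NeZero q := ⟨hF.prime_right.ne_zero⟩
  set e : (ZMod p × ZMod q) ⊕ (ZMod p × ZMod q) → G := fun s =>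
    Sum.elim (fun xy => τ ^ xy.1.val * κ ^ xy.2.val) (fun xy => ρ * (τ ^ xy.1.val * κ ^ xy.2.val)) s with he
  have hbij : Function.Bijective e := hF.coord_bijective
  have h1 : ∑ s ∈ Φ, χ (Additive.ofMul s) = ∑ g : G, if g ∈ Φ then χ (Additive.ofMul g) else 0 := by
    rw [← Finset.sum_filter, Finset.filter_mem_eq_inter, Finset.univ_inter]
  have h2 : (∑ g : G, if g ∈ Φ then χ (Additive.ofMul g) else 0) =
      ∑ s : (ZMod p × ZMod q) ⊕ (ZMod p × ZMod q), if e s ∈ Φ then χ (Additive.ofMul (e s)) else 0 :=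
    (Fintype.sum_bijective e hbij (fun s => if e s ∈ Φ then χ (Additive.ofMul (e s)) else 0)
      (fun g => if g ∈ Φ then χ (Additive.ofMul g) else 0) fun _ => rfl).symm
  rw [h1, h2, Fintype.sum_sum_type]
  unfold pairSum
  rw [← Finset.sum_add_distrib]
  refine Finset.sum_congr rfl fun xy _ => ?_
  have hval : χ (Additive.ofMul (τ ^ xy.1.val * κ ^ xy.2.val)) =
      χ (Additive.ofMul τ) ^ xy.1.val * χ (Additive.ofMul κ) ^ xy.2.val := by
    rw [char_mul, char_pow, char_pow]
  simp only [he, Sum.elim_inl, Sum.elim_inr]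
  unfold signMatrix typeSign
  by_cases hm : τ ^ xy.1.val * κ ^ xy.2.val ∈ Φ
  · have hm' : ρ * (τ ^ xy.1.val * κ ^ xy.2.val) ∉ Φ := fun h' => (rho_mul_mem_iff h _).1 h' hm
    rw [if_neg hm', if_pos hm, if_pos hm, hval, add_zero, Int.cast_one, one_mul]
  · have hm' : ρ * (τ ^ xy.1.val * κ ^ xy.2.val) ∈ Φ := (rho_mul_mem_iff h _).2 hm
    rw [if_pos hm', if_neg hm, if_neg hm, char_mul, hχ, hval, zero_add]
    push_cast
    ring

omit [Fintype G] [DecidableEq G] in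
/-- **Stability kills a character** (the easy half of Lemma 4.6.1 / of Prop. 4.7): if `uS = S` and `χ(u) ≠ 1`
then `χ(S) = χ(uS) = χ(u)χ(S)` vanishes. [cite: Hazama2003CyclicCM, Lemma 4.6.1 (proof, "⇐") and Prop. 2.3] -/
theorem sum_char_eq_zero_of_stable {u : G} (hu : ∀ s, s ∈ Φ ↔ u * s ∈ Φ) (χ : AddChar (Additive G) ℂ)
    (hχu : χ (Additive.ofMul u) ≠ 1) : ∑ s ∈ Φ, χ (Additive.ofMul s) = 0 := by
  have hre : ∑ s ∈ Φ, χ (Additive.ofMul (u * s)) = ∑ s ∈ Φ, χ (Additive.ofMul s) := by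
    refine Finset.sum_nbij' (fun s => u * s) (fun s => u⁻¹ * s) ?_ ?_ ?_ ?_ ?_
    · intro s hs; exact (hu s).1 hs
    · intro s hs; exact (hu _).2 (by rwa [mul_inv_cancel_left])
    · intro s _; exact inv_mul_cancel_left u s
    · intro s _; exact mul_inv_cancel_left u s
    · intro s _; rfl
  have h2 : ∑ s ∈ Φ, χ (Additive.ofMul (u * s)) = χ (Additive.ofMul u) * ∑ s ∈ Φ, χ (Additive.ofMul s) := by
    rw [Finset.mul_sum]
    exact Finset.sum_congr rfl fun s _ => char_mul χ u s
  rw [hre] at h2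
  have : (1 - χ (Additive.ofMul u)) * ∑ s ∈ Φ, χ (Additive.ofMul s) = 0 := by
    rw [sub_mul, one_mul, ← h2, sub_self]
  exact (mul_eq_zero.1 this).resolve_left (sub_ne_zero.2 hχu.symm)

/-- **Prop. 4.2: the odd character of order `2` never vanishes on a type** (`S_{pq} = ∅`): for `χ` odd with
`χ(τ) = χ(κ) = 1`, `χ(S) = Σ_{x,y} E(S)(x,y)` is a sum of `pq` (odd) terms `±1`, hence `≠ 0` ("since
`χ_{pq}(a) = (−1)ᵃ` and `#(S)` is odd, the character sum `χ(S)` cannot be equal to zero").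
[cite: Hazama2003CyclicCM, Prop. 4.2] -/
theorem sum_char_ne_zero_of_trivial (hF : CyclicFrame p q ρ τ κ) (h : IsCMTypeWith ρ (Φ : Set G))
    (χ : AddChar (Additive G) ℂ) (hχ : χ (Additive.ofMul ρ) = -1) (hτ : χ (Additive.ofMul τ) = 1)
    (hκ : χ (Additive.ofMul κ) = 1) : ∑ s ∈ Φ, χ (Additive.ofMul s) ≠ 0 := by
  haveI : NeZero p := ⟨hF.prime_left.ne_zero⟩
  haveI : NeZero q := ⟨hF.prime_right.ne_zero⟩
  rw [sum_char_eq_pairSum hF h χ hχ, hτ, hκ]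
  unfold pairSum
  simp only [one_pow, mul_one]
  -- the sum of `pq` signs is odd
  set B := (Finset.univ.filter fun xy : ZMod p × ZMod q => τ ^ xy.1.val * κ ^ xy.2.val ∈ Φ).card with hB
  have hsum : ∑ xy : ZMod p × ZMod q, (signMatrix p q Φ τ κ xy : ℂ) = 2 * (B : ℂ) - (p * q : ℕ) := by
    have hre : ∀ xy : ZMod p × ZMod q, (signMatrix p q Φ τ κ xy : ℂ) =
        2 * (if τ ^ xy.1.val * κ ^ xy.2.val ∈ Φ then (1 : ℂ) else 0) - 1 := fun xy => by
      unfold signMatrix typeSign; split_ifs <;> norm_num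
    simp_rw [hre]
    rw [Finset.sum_sub_distrib, ← Finset.mul_sum, Finset.sum_boole, Finset.sum_const, Finset.card_univ,
      Fintype.card_prod, ZMod.card, ZMod.card, hB]
    simp
  rw [hsum]
  obtain ⟨m, hm⟩ := hF.odd_mul
  rw [hm]
  intro h0
  have h1 : (2 * (B : ℂ) : ℂ) = ((2 * m + 1 : ℕ) : ℂ) := by linear_combination h0
  have h2 : 2 * B = 2 * m + 1 := by exact_mod_cast h1
  omega

end CharacterSum

/-! ## §4 Propositions 4.3–4.7 and Lemma 4.6.1 on the group -/

section Stability

variable {G : Type*} [CommGroup G]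

/-- **`S` is stable under `u`**: `uS = S` ("`S` is stable under the action of `ℤ/2pℤ`", i.e. under the subgroup
generated by `u`; Prop. 2.3: "A CM-type `S` is primitive if and only if it is not stable under any elements of
`G − {g₁}`"). [cite: Hazama2003CyclicCM, Prop. 2.3 and Lemma 4.6.1] -/
def IsStableUnder (Φ : Finset G) (u : G) : Prop := ∀ s : G, s ∈ Φ ↔ u * s ∈ Φ

/-- Stability under `u` gives stability under every power of `u`. [cite: Hazama2003CyclicCM, Prop. 2.3] -/
theorem IsStableUnder.pow {Φ : Finset G} {u : G} (hu : IsStableUnder Φ u) (k : ℕ) :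
    IsStableUnder Φ (u ^ k) := by
  induction k with
  | zero => intro s; rw [pow_zero, one_mul]
  | succ k ih => intro s; rw [pow_succ', mul_assoc, ← hu, ← ih]

/-- **Prop. 2.3 in separation form**: some `u ≠ 1` stabilises `S` iff the translates of `S` do NOT separate the
points of `G` (the tree's primitivity criterion `isPrimitive_iff_forall_eq`: for `x ≠ y` with `gx ∈ S ↔ gy ∈ S`
for all `g`, `u = yx⁻¹` stabilises `S`). [cite: Hazama2003CyclicCM, Prop. 2.3] -/
theorem exists_isStableUnder_iff_not_separating (Φ : Finset G) :
    (∃ u : G, u ≠ 1 ∧ IsStableUnder Φ u) ↔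
      ¬ ∀ x y : G, (∀ g : G, g • x ∈ (Φ : Set G) ↔ g • y ∈ (Φ : Set G)) → x = y := by
  constructor
  · rintro ⟨u, hu1, hu⟩ hsep
    refine hu1 (hsep 1 u fun g => ?_).symm
    rw [smul_eq_mul, smul_eq_mul, mul_one, Finset.mem_coe, Finset.mem_coe, hu g, mul_comm]
  · intro hsep
    push Not at hsep
    obtain ⟨x, y, hxy, hne⟩ := hsep
    refine ⟨y * x⁻¹, fun h1 => hne ?_, fun s => ?_⟩
    · rw [mul_inv_eq_one] at h1
      exact h1.symm
    · have h := hxy (s * x⁻¹)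
      rw [smul_eq_mul, smul_eq_mul, inv_mul_cancel_right, Finset.mem_coe, Finset.mem_coe] at h
      rw [h, mul_assoc, mul_comm s (x⁻¹ * y), mul_comm x⁻¹ y]

end Stability

section Propositions

variable {G : Type*} [CommGroup G] [Fintype G] [DecidableEq G] {p q : ℕ} {ρ τ κ : G} {Φ : Finset G}

/-- **Constant row sums** of Hazama's `(0,1)`-matrix: `#{x : τˣκʸ ∈ S}` does not depend on `y ∈ ℤ/q`
(Prop. 4.3: the types in `S_p` "correspond to the `q × p` `(0,1)`-matrices with constant row sum").
[cite: Hazama2003CyclicCM, Prop. 4.3 and (4.5)] -/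
def HasConstantRows (p q : ℕ) [NeZero p] (Φ : Finset G) (τ κ : G) : Prop :=
  ∀ y y' : ZMod q, rowCount p q Φ τ κ y = rowCount p q Φ τ κ y'

omit [Fintype G] [DecidableEq G] in
/-- `χ(κ)` is a primitive `q`-th root of unity as soon as `χ(κ) ≠ 1` (`κ` of prime order `q`). [folklore] -/
private theorem isPrimitiveRoot_char_of_ne_one {u : G} {r : ℕ} (hr : r.Prime) (hu : orderOf u = r)
    (χ : AddChar (Additive G) ℂ) (hχ : χ (Additive.ofMul u) ≠ 1) : IsPrimitiveRoot (χ (Additive.ofMul u)) r := by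
  haveI : Fact r.Prime := ⟨hr⟩
  have hpow : χ (Additive.ofMul u) ^ r = 1 := by
    rw [← char_pow, ← hu, pow_orderOf_eq_one, ofMul_one, AddChar.map_zero_eq_one]
  exact IsPrimitiveRoot.iff_orderOf.2 (orderOf_eq_prime hpow hχ)

/-- **Prop. 4.3 on the group.**  For an odd character `χ` trivial on `⟨τ⟩` and non-trivial on `⟨κ⟩` (a character
of order `2q`): `χ(S) = 0` iff the rows of `S` have constant counts `#{x : τˣκʸ ∈ S}` ("there exists a natural
bijection between the set `S_p` and the set of `q × p` `(0,1)`-matrices with constant row sum").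
[cite: Hazama2003CyclicCM, Prop. 4.3] -/
theorem sum_char_eq_zero_iff_hasConstantRows (hF : CyclicFrame p q ρ τ κ) (h : IsCMTypeWith ρ (Φ : Set G))
    (χ : AddChar (Additive G) ℂ) (hχ : χ (Additive.ofMul ρ) = -1) (hτ : χ (Additive.ofMul τ) = 1)
    (hκ : χ (Additive.ofMul κ) ≠ 1) :
    haveI : NeZero p := ⟨hF.prime_left.ne_zero⟩
    ∑ s ∈ Φ, χ (Additive.ofMul s) = 0 ↔ HasConstantRows p q Φ τ κ := by
  haveI : NeZero p := ⟨hF.prime_left.ne_zero⟩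
  haveI : Fact q.Prime := ⟨hF.prime_right⟩
  have hν := isPrimitiveRoot_char_of_ne_one hF.prime_right hF.orderOf_kappa χ hκ
  rw [sum_char_eq_pairSum hF h χ hχ, hτ, pairSum_one_left_eq_zero_iff hν]
  exact forall_sum_signMatrix_row_eq_iff p q Φ τ κ

/-- **Prop. 4.4 on the group** (the symmetric statement): for an odd character `χ` non-trivial on `⟨τ⟩` and trivial
on `⟨κ⟩` (order `2p`): `χ(S) = 0` iff the COLUMNS of `S` have constant counts `#{y : τˣκʸ ∈ S}`.
[cite: Hazama2003CyclicCM, Prop. 4.4] -/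
theorem sum_char_eq_zero_iff_hasConstantRows_swap (hF : CyclicFrame p q ρ τ κ)
    (h : IsCMTypeWith ρ (Φ : Set G)) (χ : AddChar (Additive G) ℂ) (hχ : χ (Additive.ofMul ρ) = -1)
    (hτ : χ (Additive.ofMul τ) ≠ 1) (hκ : χ (Additive.ofMul κ) = 1) :
    haveI : NeZero q := ⟨hF.prime_right.ne_zero⟩
    ∑ s ∈ Φ, χ (Additive.ofMul s) = 0 ↔ HasConstantRows q p Φ κ τ :=
  sum_char_eq_zero_iff_hasConstantRows hF.swap h χ hχ hκ hτ

/-- **`E(S)` constant along `x` ⟺ `S` is `τ`-stable** (the dictionary between Hazama's "`E(S)` is stable under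
the action of `ℤ/pℤ`" and "`S` is stable under `ℤ/2pℤ`", (4.7)). [cite: Hazama2003CyclicCM, Lemma 4.6.1 ((4.7))] -/
theorem forall_signMatrix_eq_left_iff (hF : CyclicFrame p q ρ τ κ) (h : IsCMTypeWith ρ (Φ : Set G)) :
    (∀ (x x' : ZMod p) (y : ZMod q), signMatrix p q Φ τ κ (x, y) = signMatrix p q Φ τ κ (x', y)) ↔
      IsStableUnder Φ τ := by
  haveI : NeZero p := ⟨hF.prime_left.ne_zero⟩
  have hstep : ∀ (x : ZMod p) (y : ZMod q),
      τ * (τ ^ x.val * κ ^ y.val) = τ ^ (x + 1).val * κ ^ y.val := fun x y => by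
    rw [hF.tau_pow_val_add, hF.tau_pow_val_one, ← mul_assoc, mul_comm τ]
  constructor
  · intro H s
    obtain ⟨xy, rfl | rfl⟩ := hF.exists_coord s
    · rw [hstep, ← typeSign_eq_typeSign_iff]
      exact H xy.1 (xy.1 + 1) xy.2
    · rw [mul_left_comm τ ρ (τ ^ xy.1.val * κ ^ xy.2.val), hstep, rho_mul_mem_iff h, rho_mul_mem_iff h,
        not_iff_not, ← typeSign_eq_typeSign_iff]
      exact H xy.1 (xy.1 + 1) xy.2
  · intro H
    have h1 : ∀ (x : ZMod p) (y : ZMod q), signMatrix p q Φ τ κ (x + 1, y) = signMatrix p q Φ τ κ (x, y) := by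
      intro x y
      unfold signMatrix
      rw [typeSign_eq_typeSign_iff]
      simp only
      rw [← hstep]
      exact (H _).symm
    have h2 : ∀ (k : ℕ) (x : ZMod p) (y : ZMod q),
        signMatrix p q Φ τ κ (x + k, y) = signMatrix p q Φ τ κ (x, y) := by
      intro k
      induction k with
      | zero => intro x y; rw [Nat.cast_zero, add_zero]
      | succ k ih => intro x y; rw [Nat.cast_succ, ← add_assoc, h1, ih]
    intro x x' y
    have hx' : x' = x + ((x' - x).val : ZMod p) := by rw [ZMod.natCast_zmod_val, add_sub_cancel]
    rw [hx', h2]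

/-- **`E(S)` constant along `y` ⟺ `S` is `κ`-stable.** [cite: Hazama2003CyclicCM, Lemma 4.6.1 ((4.7))] -/
theorem forall_signMatrix_eq_right_iff (hF : CyclicFrame p q ρ τ κ) (h : IsCMTypeWith ρ (Φ : Set G)) :
    (∀ (x : ZMod p) (y y' : ZMod q), signMatrix p q Φ τ κ (x, y) = signMatrix p q Φ τ κ (x, y')) ↔
      IsStableUnder Φ κ := by
  rw [← forall_signMatrix_eq_left_iff hF.swap h]
  simp_rw [signMatrix_swap]
  exact ⟨fun H y y' x => H x y y', fun H x y y' => H y y' x⟩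

/-- **Lemma 4.6.1 on the group.**  For an odd character `χ` non-trivial on `⟨τ⟩` and on `⟨κ⟩` (a faithful odd
character, order `2pq`): `χ(S) = 0` iff `S` is stable under `⟨τ⟩` or under `⟨κ⟩` ("A CM-type `S` belongs to
`S₁` if and only if `S` is stable under the action of either `ℤ/2pℤ` or `ℤ/2qℤ`").
[cite: Hazama2003CyclicCM, Lemma 4.6.1] -/
theorem sum_char_eq_zero_iff_isStableUnder (hF : CyclicFrame p q ρ τ κ) (h : IsCMTypeWith ρ (Φ : Set G))
    (χ : AddChar (Additive G) ℂ) (hχ : χ (Additive.ofMul ρ) = -1) (hτ : χ (Additive.ofMul τ) ≠ 1)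
    (hκ : χ (Additive.ofMul κ) ≠ 1) :
    ∑ s ∈ Φ, χ (Additive.ofMul s) = 0 ↔ IsStableUnder Φ τ ∨ IsStableUnder Φ κ := by
  haveI : Fact p.Prime := ⟨hF.prime_left⟩
  haveI : Fact q.Prime := ⟨hF.prime_right⟩
  have hμ := isPrimitiveRoot_char_of_ne_one hF.prime_left hF.orderOf_tau χ hτ
  have hν := isPrimitiveRoot_char_of_ne_one hF.prime_right hF.orderOf_kappa χ hκ
  rw [sum_char_eq_pairSum hF h χ hχ, pairSum_eq_zero_iff hF.ne hμ hν _ (signMatrix_eq_or p q Φ τ κ),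
    forall_signMatrix_eq_left_iff hF h, forall_signMatrix_eq_right_iff hF h]

omit [Fintype G] [DecidableEq G] in
/-- A CM type is non-empty: it contains `1` or `ρ`. [cite: Hazama2003CyclicCM, §4 ("`S ⊔ Sρ = G`")] -/
theorem one_mem_or_rho_mem (h : IsCMTypeWith ρ (Φ : Set G)) : (1 : G) ∈ Φ ∨ ρ ∈ Φ := by
  by_cases h1 : (1 : G) ∈ Φ
  · exact Or.inl h1
  · exact Or.inr (by simpa using (rho_mul_mem_iff h 1).2 h1)

omit [DecidableEq G] in
/-- **Prop. 2.3 for the cyclic group of order `2pq`**: a non-trivial element stabilises `S` iff `τ` or `κ` does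
(the stabiliser is a subgroup not containing `ρ`, hence a subgroup of `⟨τ⟩ × ⟨κ⟩`; if it is `≠ 1` it contains
`⟨τ⟩` or `⟨κ⟩`). [cite: Hazama2003CyclicCM, Prop. 2.3 and Prop. 4.6] -/
theorem exists_isStableUnder_iff (hF : CyclicFrame p q ρ τ κ) (h : IsCMTypeWith ρ (Φ : Set G)) :
    (∃ u : G, u ≠ 1 ∧ IsStableUnder Φ u) ↔ IsStableUnder Φ τ ∨ IsStableUnder Φ κ := by
  haveI : NeZero p := ⟨hF.prime_left.ne_zero⟩
  haveI : NeZero q := ⟨hF.prime_right.ne_zero⟩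
  have hτ1 : τ ≠ 1 := fun e => by
    have := hF.orderOf_tau; rw [e, orderOf_one] at this; exact hF.prime_left.one_lt.ne this
  have hκ1 : κ ≠ 1 := fun e => by
    have := hF.orderOf_kappa; rw [e, orderOf_one] at this; exact hF.prime_right.one_lt.ne this
  constructor
  · rintro ⟨u, hu1, hu⟩
    obtain ⟨⟨x, y⟩, rfl | rfl⟩ := hF.exists_coord u
    · -- `u = τˣκʸ ≠ 1`
      simp only at hu1 hu ⊢
      by_cases hx : x = 0
      · -- then `y ≠ 0` and `u = κʸ` generates `⟨κ⟩`
        subst hx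
        have hy : y.val ≠ 0 := by
          intro hy
          rw [ZMod.val_eq_zero] at hy
          apply hu1; rw [hy, ZMod.val_zero, ZMod.val_zero, pow_zero, pow_zero, mul_one]
        rw [ZMod.val_zero, pow_zero, one_mul] at hu
        have hcop : y.val.Coprime (orderOf κ) := by
          rw [hF.orderOf_kappa]
          exact (Nat.coprime_of_lt_prime hy (ZMod.val_lt y) hF.prime_right).symm
        obtain ⟨m, hm⟩ := exists_pow_eq_self_of_coprime hcop
        exact Or.inr (hm ▸ hu.pow m)
      · have hx' : x.val ≠ 0 := by rwa [ne_eq, ZMod.val_eq_zero]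
        have hq := hu.pow q
        have e : (τ ^ x.val * κ ^ y.val) ^ q = τ ^ (x.val * q) := by
          rw [mul_pow, ← pow_mul, ← pow_mul, mul_comm y.val, pow_mul κ, hF.kappa_pow, one_pow, mul_one]
        rw [e] at hq
        have hcop : (x.val * q).Coprime (orderOf τ) := by
          rw [hF.orderOf_tau]
          exact Nat.Coprime.mul_left (Nat.coprime_of_lt_prime hx' (ZMod.val_lt x) hF.prime_left).symm
            hF.coprime.symm
        obtain ⟨m, hm⟩ := exists_pow_eq_self_of_coprime hcop
        exact Or.inl (hm ▸ hq.pow m)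
    · -- `u = ρτˣκʸ`: then `u^{pq} = ρ` would stabilise `S`, impossible
      exfalso
      have hpq := hu.pow (p * q)
      rw [mul_pow, hF.rho_pow_mul, hF.pow_mul_pow_pow_mul, mul_one] at hpq
      rcases one_mem_or_rho_mem h with h1 | h1
      · exact (rho_mul_mem_iff h 1).1 ((hpq 1).1 h1) h1
      · have := (hpq ρ).1 h1
        rw [hF.rho_mul_rho] at this
        exact (rho_mul_mem_iff h 1).1 (by rw [mul_one]; exact h1) this
  · rintro (H | H)
    · exact ⟨τ, hτ1, H⟩
    · exact ⟨κ, hκ1, H⟩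

/-- **Theorem 4.8 (iii), `Nonprim = S₁`**: a faithful odd character vanishes on `S` iff `S` is NOT primitive
(its translates do not separate points, i.e. some `u ≠ 1` stabilises it).
[cite: Hazama2003CyclicCM, Thm. 4.8 (iii) and Prop. 4.6] -/
theorem sum_char_eq_zero_iff_not_separating (hF : CyclicFrame p q ρ τ κ) (h : IsCMTypeWith ρ (Φ : Set G))
    (χ : AddChar (Additive G) ℂ) (hχ : χ (Additive.ofMul ρ) = -1) (hτ : χ (Additive.ofMul τ) ≠ 1)
    (hκ : χ (Additive.ofMul κ) ≠ 1) :
    ∑ s ∈ Φ, χ (Additive.ofMul s) = 0 ↔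
      ¬ ∀ x y : G, (∀ g : G, g • x ∈ (Φ : Set G) ↔ g • y ∈ (Φ : Set G)) → x = y := by
  rw [sum_char_eq_zero_iff_isStableUnder hF h χ hχ hτ hκ, ← exists_isStableUnder_iff hF h,
    exists_isStableUnder_iff_not_separating]

omit [Fintype G] in
/-- The total count `#{(x, y) : τˣκʸ ∈ S}` is the sum of the row counts. [cite: Hazama2003CyclicCM, Prop. 4.5 (proof)] -/
theorem sum_rowCount_eq (p q : ℕ) [NeZero p] [NeZero q] (Φ : Finset G) (τ κ : G) :
    ∑ y : ZMod q, rowCount p q Φ τ κ y =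
      (Finset.univ.filter fun xy : ZMod p × ZMod q => τ ^ xy.1.val * κ ^ xy.2.val ∈ Φ).card := by
  unfold rowCount
  rw [Finset.card_filter, Fintype.sum_prod_type_right]
  refine Finset.sum_congr rfl fun y _ => ?_
  rw [Finset.card_filter]

omit [Fintype G] in
/-- … and the sum of the column counts (the row counts of the swapped frame). [cite: Hazama2003CyclicCM, Prop. 4.5 (proof)] -/
theorem sum_rowCount_swap_eq (p q : ℕ) [NeZero p] [NeZero q] (Φ : Finset G) (τ κ : G) :
    ∑ x : ZMod p, rowCount q p Φ κ τ x =
      (Finset.univ.filter fun xy : ZMod p × ZMod q => τ ^ xy.1.val * κ ^ xy.2.val ∈ Φ).card := by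
  unfold rowCount
  rw [Finset.card_filter, Fintype.sum_prod_type]
  refine Finset.sum_congr rfl fun x _ => ?_
  rw [Finset.card_filter]
  refine Finset.sum_congr rfl fun y _ => ?_
  rw [mul_comm]

omit [Fintype G] in
/-- A row count is at most `p`. [cite: Hazama2003CyclicCM, Prop. 4.3] -/
theorem rowCount_le (p q : ℕ) [NeZero p] (Φ : Finset G) (τ κ : G) (y : ZMod q) : rowCount p q Φ τ κ y ≤ p := by
  unfold rowCount
  exact (Finset.card_filter_le _ _).trans (by rw [Finset.card_univ, ZMod.card])

/-- **Prop. 4.5: `S_p ∩ S_q = {S_even, S_odd}`.**  If both the rows and the columns of `S` have constant counts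
then `S` contains all of the odd part `{τˣκʸ}` or none of it ("`#{a ; e_a = 1}` is divisible by `q` … and by
`p`, hence by `pq`, and we have `e_a = 1` (resp. `= 0`) for any `a`").  [cite: Hazama2003CyclicCM, Prop. 4.5] -/
theorem forall_mem_or_forall_not_mem_of_hasConstantRows (hF : CyclicFrame p q ρ τ κ)
    (hr : haveI : NeZero p := ⟨hF.prime_left.ne_zero⟩; HasConstantRows p q Φ τ κ)
    (hc : haveI : NeZero q := ⟨hF.prime_right.ne_zero⟩; HasConstantRows q p Φ κ τ) :
    (∀ xy : ZMod p × ZMod q, τ ^ xy.1.val * κ ^ xy.2.val ∈ Φ) ∨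
      (∀ xy : ZMod p × ZMod q, τ ^ xy.1.val * κ ^ xy.2.val ∉ Φ) := by
  haveI : NeZero p := ⟨hF.prime_left.ne_zero⟩
  haveI : NeZero q := ⟨hF.prime_right.ne_zero⟩
  set T := (Finset.univ.filter fun xy : ZMod p × ZMod q => τ ^ xy.1.val * κ ^ xy.2.val ∈ Φ).card with hT
  set c := rowCount p q Φ τ κ 0 with hc_def
  set c' := rowCount q p Φ κ τ 0 with hc'_def
  have hrow : ∀ y, rowCount p q Φ τ κ y = c := fun y => hr y 0
  have hcol : ∀ x, rowCount q p Φ κ τ x = c' := fun x => hc x 0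
  have h1 : q * c = T := by
    rw [hT, ← sum_rowCount_eq p q Φ τ κ, Finset.sum_congr rfl fun y _ => hrow y, Finset.sum_const,
      Finset.card_univ, ZMod.card, smul_eq_mul]
  have h2 : p * c' = T := by
    rw [hT, ← sum_rowCount_swap_eq p q Φ τ κ, Finset.sum_congr rfl fun x _ => hcol x, Finset.sum_const,
      Finset.card_univ, ZMod.card, smul_eq_mul]
  have hdvd : p ∣ c := Nat.Coprime.dvd_of_dvd_mul_left hF.coprime ⟨c', by rw [h1, ← h2]⟩
  have hle : c ≤ p := rowCount_le p q Φ τ κ 0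
  obtain ⟨k, hk⟩ := hdvd
  rcases Nat.eq_zero_or_pos k with hk0 | hk0
  · -- `c = 0`: every row is empty
    right
    rintro ⟨x, y⟩
    have h0 : rowCount p q Φ τ κ y = 0 := by rw [hrow, hk, hk0, mul_zero]
    unfold rowCount at h0
    rw [Finset.card_eq_zero, Finset.filter_eq_empty_iff] at h0
    exact h0 (Finset.mem_univ x)
  · -- `c = p`: every row is full
    left
    have hcp : c = p := by
      refine le_antisymm hle ?_
      rw [hk]; exact Nat.le_mul_of_pos_right p hk0
    rintro ⟨x, y⟩
    have hp' : rowCount p q Φ τ κ y = (Finset.univ : Finset (ZMod p)).card := by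
      rw [hrow, hcp, Finset.card_univ, ZMod.card]
    unfold rowCount at hp'
    rw [Finset.card_filter_eq_iff] at hp'
    exact hp' x (Finset.mem_univ x)

/-- **Prop. 4.5, corollary: `S_p ∩ S_q ⊂ S₁`** — such types are stable under `τ` AND `κ` (they are `S_even`,
`S_odd`, "stable under the addition of even elements", hence not primitive). [cite: Hazama2003CyclicCM, Prop. 4.5] -/
theorem isStableUnder_and_of_hasConstantRows (hF : CyclicFrame p q ρ τ κ) (h : IsCMTypeWith ρ (Φ : Set G))
    (hr : haveI : NeZero p := ⟨hF.prime_left.ne_zero⟩; HasConstantRows p q Φ τ κ)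
    (hc : haveI : NeZero q := ⟨hF.prime_right.ne_zero⟩; HasConstantRows q p Φ κ τ) :
    IsStableUnder Φ τ ∧ IsStableUnder Φ κ := by
  have key : ∀ xy xy' : ZMod p × ZMod q, signMatrix p q Φ τ κ xy = signMatrix p q Φ τ κ xy' := by
    intro xy xy'
    unfold signMatrix
    rw [typeSign_eq_typeSign_iff]
    rcases forall_mem_or_forall_not_mem_of_hasConstantRows hF hr hc with H | H
    · exact iff_of_true (H xy) (H xy')
    · exact iff_of_false (H xy) (H xy')
  exact ⟨(forall_signMatrix_eq_left_iff hF h).1 fun x x' y => key _ _,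
    (forall_signMatrix_eq_right_iff hF h).1 fun x y y' => key _ _⟩

omit [Fintype G] in
/-- Row counts in terms of `E(S)`: `#{x : τˣκʸ ∈ S} = #{x : E(S)(x,y) = 1}`. [cite: Hazama2003CyclicCM, Prop. 4.3 (proof)] -/
theorem rowCount_eq_card_filter_signMatrix (p q : ℕ) [NeZero p] (Φ : Finset G) (τ κ : G) (y : ZMod q) :
    rowCount p q Φ τ κ y = (Finset.univ.filter fun x : ZMod p => signMatrix p q Φ τ κ (x, y) = 1).card := by
  unfold rowCount
  congr 1
  exact Finset.filter_congr fun x _ => (signMatrix_eq_one_iff p q Φ τ κ (x, y)).symm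

/-- **Prop. 4.7: `S₁ ∩ S_p` is the set of `κ`-stable types** ("`S₁ ∩ S_r = {S ; E(S) = Σ_i ε_i χ_i^{(r)}}`", the
types whose `E(S)` is constant on the residue classes modulo `r`; `#(S₁ ∩ S_p) = 2^p`): `S` is `κ`-stable iff
(`S` is `τ`- or `κ`-stable) and its rows have constant counts. [cite: Hazama2003CyclicCM, Prop. 4.7] -/
theorem isStableUnder_right_iff (hF : CyclicFrame p q ρ τ κ) (h : IsCMTypeWith ρ (Φ : Set G)) :
    haveI : NeZero p := ⟨hF.prime_left.ne_zero⟩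
    IsStableUnder Φ κ ↔ (IsStableUnder Φ τ ∨ IsStableUnder Φ κ) ∧ HasConstantRows p q Φ τ κ := by
  haveI : NeZero p := ⟨hF.prime_left.ne_zero⟩
  haveI : NeZero q := ⟨hF.prime_right.ne_zero⟩
  constructor
  · intro H
    refine ⟨Or.inr H, fun y y' => ?_⟩
    have Hy := (forall_signMatrix_eq_right_iff hF h).2 H
    rw [rowCount_eq_card_filter_signMatrix, rowCount_eq_card_filter_signMatrix]
    congr 1
    exact Finset.filter_congr fun x _ => by rw [Hy x y y']
  · rintro ⟨H | H, hr⟩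
    · -- `τ`-stable with constant rows: every row is full or empty, and all rows have the same count
      have Hx := (forall_signMatrix_eq_left_iff hF h).2 H
      rw [← forall_signMatrix_eq_right_iff hF h]
      intro x y y'
      rw [Hx x 0 y, Hx x 0 y']
      -- compare the rows `y` and `y'` through their counts
      have hcount : ∀ z : ZMod q, rowCount p q Φ τ κ z =
          if signMatrix p q Φ τ κ (0, z) = 1 then p else 0 := by
        intro z
        rw [rowCount_eq_card_filter_signMatrix]
        split_ifs with hz
        · rw [Finset.filter_true_of_mem fun x _ => by rw [Hx x 0 z, hz], Finset.card_univ, ZMod.card]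
        · rw [Finset.card_eq_zero, Finset.filter_eq_empty_iff]
          intro x _; rw [Hx x 0 z]; exact hz
      have hyy := hr y y'
      rw [hcount, hcount] at hyy
      have hp0 : p ≠ 0 := hF.prime_left.ne_zero
      rcases signMatrix_eq_or p q Φ τ κ (0, y) with e | e <;>
        rcases signMatrix_eq_or p q Φ τ κ (0, y') with e' | e'
      · rw [e, e']
      · exfalso
        rw [if_pos e, if_neg (by rw [e']; norm_num)] at hyy
        exact hp0 hyy
      · exfalso
        rw [if_neg (by rw [e]; norm_num), if_pos e'] at hyy
        exact hp0 hyy.symm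
      · rw [e, e']
    · exact H

end Propositions

/-! ## §5 Hazama's height-one kernel elements: balanced subsets of weight `p` (§5 of the paper), and Theorem 4.8 (ii) -/

section Balanced

variable {G : Type*} [CommGroup G] [Fintype G] [DecidableEq G] {p q : ℕ} {ρ τ κ : G} {Φ : Finset G}

omit [DecidableEq G] in
/-- Pohlmann's condition for the indicator of a finite set `Δ ⊆ G`: `Δ` is balanced for `S` iff
`2·#{d ∈ Δ : gd ∈ S} = #Δ` for every `g` (Hazama's (5.1) "`⟨h, f_{a+S}⟩ = 0` for any `a`" for the height-one
function `h = 𝟙_Δ`). [cite: Hazama2003CyclicCM, §5 (5.1)] -/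
theorem isBalanced_indicator_iff [DecidableEq G] (Φ Δ : Finset G) :
    IsBalanced G (Φ : Set G) (fun d => if d ∈ Δ then (1 : ℚ) else 0) ↔
      ∀ g : G, 2 * (Δ.filter fun d => g * d ∈ Φ).card = Δ.card := by
  unfold IsBalanced
  have h1 : ∀ g : G, ∑ x : G, (if x ∈ Δ then (1 : ℚ) else 0) * translateInd (Φ : Set G) g x =
      ((Δ.filter fun d => g * d ∈ Φ).card : ℚ) := by
    intro g
    rw [Finset.card_filter, Nat.cast_sum, ← Finset.sum_filter_add_sum_filter_not Finset.univ (· ∈ Δ)]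
    rw [Finset.filter_mem_eq_inter, Finset.univ_inter]
    have hzero : ∑ x ∈ Finset.univ.filter (fun x => x ∉ Δ),
        (if x ∈ Δ then (1 : ℚ) else 0) * translateInd (Φ : Set G) g x = 0 :=
      Finset.sum_eq_zero fun x hx => by rw [if_neg (Finset.mem_filter.1 hx).2, zero_mul]
    rw [hzero, add_zero]
    refine Finset.sum_congr rfl fun x hx => ?_
    rw [if_pos hx, one_mul]
    unfold translateInd
    simp only [smul_eq_mul, Finset.mem_coe]
    split_ifs <;> simp
  have h2 : ∑ x : G, (if x ∈ Δ then (1 : ℚ) else 0) = (Δ.card : ℚ) := by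
    rw [Finset.sum_boole, Finset.filter_mem_eq_inter, Finset.univ_inter]
  simp_rw [h1, h2]
  constructor
  · intro H g; exact_mod_cast H g
  · intro H g; exact_mod_cast H g

/-- **Hazama's height-one, weight-`p` elements `w_k^{(2q)}` as subsets of `G`**: for `y₁, y₂ ∈ ℤ/q`,
`Δ(y₁, y₂) = {τˣκ^{y₁} : x ∈ ℤ/p} ∪ {ρτˣκ^{y₂} : x ∈ ℤ/p}` — a coset of `⟨τ⟩` in the odd part together with
the conjugate of another one ((3.2): `g_k^{(2r)}(a) = 1` for `a ≡ 0 (mod 2r)`, `−1` for `a ≡ r (mod 2r)`, read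
through `F : h ↦ ĥ` of (5.2)). [cite: Hazama2003CyclicCM, Prop. 3.2 (3.2) and §5 (5.2)] -/
def hazamaSet (p : ℕ) [NeZero p] {q : ℕ} (ρ τ κ : G) (y₁ y₂ : ZMod q) : Finset G :=
  (Finset.univ.image fun x : ZMod p => τ ^ x.val * κ ^ y₁.val) ∪
    (Finset.univ.image fun x : ZMod p => ρ * (τ ^ x.val * κ ^ y₂.val))

/-- The two halves of `Δ(y₁, y₂)` are disjoint (`ρ` is not in the odd part). [cite: Hazama2003CyclicCM, §5] -/
theorem disjoint_hazamaSet_parts (hF : CyclicFrame p q ρ τ κ) (y₁ y₂ : ZMod q) :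
    haveI : NeZero p := ⟨hF.prime_left.ne_zero⟩
    Disjoint (Finset.univ.image fun x : ZMod p => τ ^ x.val * κ ^ y₁.val)
      (Finset.univ.image fun x : ZMod p => ρ * (τ ^ x.val * κ ^ y₂.val)) := by
  haveI : NeZero p := ⟨hF.prime_left.ne_zero⟩
  rw [Finset.disjoint_left]
  intro d hd hd'
  obtain ⟨x, -, rfl⟩ := Finset.mem_image.1 hd
  obtain ⟨x', -, he⟩ := Finset.mem_image.1 hd'
  exact hF.pow_mul_pow_ne_rho_mul _ _ _ _ he.symm

omit [DecidableEq G] in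
/-- `x ↦ τˣκʸ` is injective on `ℤ/p` (fixed `y`). [cite: Hazama2003CyclicCM, §4] -/
theorem pow_mul_pow_injective_left (hF : CyclicFrame p q ρ τ κ) (y : ZMod q) :
    Function.Injective fun x : ZMod p => τ ^ x.val * κ ^ y.val := fun x x' h =>
  (Prod.ext_iff.1 (hF.pow_mul_pow_injective (a₁ := (x, y)) (a₂ := (x', y)) h)).1

omit [DecidableEq G] in
/-- `x ↦ ρτˣκʸ` is injective on `ℤ/p` (fixed `y`). [cite: Hazama2003CyclicCM, §4] -/
theorem rho_mul_pow_mul_pow_injective_left (hF : CyclicFrame p q ρ τ κ) (y : ZMod q) :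
    Function.Injective fun x : ZMod p => ρ * (τ ^ x.val * κ ^ y.val) := fun _ _ h =>
  pow_mul_pow_injective_left hF y (mul_left_cancel h)

/-- **`#Δ(y₁, y₂) = 2p`** (weight `p`). [cite: Hazama2003CyclicCM, §5 ("the weight … equal to `p`")] -/
theorem card_hazamaSet (hF : CyclicFrame p q ρ τ κ) (y₁ y₂ : ZMod q) :
    haveI : NeZero p := ⟨hF.prime_left.ne_zero⟩
    (hazamaSet p ρ τ κ y₁ y₂).card = 2 * p := by
  haveI : NeZero p := ⟨hF.prime_left.ne_zero⟩
  unfold hazamaSet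
  rw [Finset.card_union_of_disjoint (disjoint_hazamaSet_parts hF y₁ y₂),
    Finset.card_image_of_injective _ (pow_mul_pow_injective_left hF y₁),
    Finset.card_image_of_injective _ (rho_mul_pow_mul_pow_injective_left hF y₂), Finset.card_univ, ZMod.card,
    two_mul]

omit [Fintype G] in
/-- Translating a row of the `(0,1)`-matrix: `#{x : τ^{x+a}κ^{c} ∈ S} = #{x : τˣκ^{c} ∈ S}`. [folklore] -/
private theorem card_filter_add_eq (hp : NeZero p) (a : ZMod p) (P : ZMod p → Prop) [DecidablePred P] :
    (Finset.univ.filter fun x : ZMod p => P (x + a)).card = (Finset.univ.filter P).card := by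
  refine Finset.card_bij (fun x _ => x + a) (fun x hx => ?_) (fun x _ x' _ h => add_right_cancel h)
    fun x hx => ⟨x - a, ?_, sub_add_cancel x a⟩
  · exact Finset.mem_filter.2 ⟨Finset.mem_univ _, (Finset.mem_filter.1 hx).2⟩
  · refine Finset.mem_filter.2 ⟨Finset.mem_univ _, ?_⟩
    rw [sub_add_cancel]; exact (Finset.mem_filter.1 hx).2

omit [Fintype G] in
/-- Complementary row count: `#{x : τˣκʸ ∉ S} = p − #{x : τˣκʸ ∈ S}`. [folklore] -/
private theorem card_filter_not_mem_row (hp : NeZero p) (Φ : Finset G) (τ κ : G) (y : ZMod q) :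
    (Finset.univ.filter fun x : ZMod p => τ ^ x.val * κ ^ y.val ∉ Φ).card = p - rowCount p q Φ τ κ y := by
  unfold rowCount
  have := Finset.card_filter_add_card_filter_not
    (s := (Finset.univ : Finset (ZMod p))) (fun x : ZMod p => τ ^ x.val * κ ^ y.val ∈ Φ)
  rw [Finset.card_univ, ZMod.card] at this
  omega

/-- **Hazama's `w_k` are kernel elements: `Δ(y₁, y₂)` is balanced** for every type with constant row counts `c`:
for `g = ρᵉτᵃκᵇ`, `gΔ ∩ S` consists of `c` (resp. `p − c`) elements of the translated coset and `p − c` (resp. `c`)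
of the translated conjugate coset — `p` in all ("`⟨h, f_{a+S}⟩ = 0` for any `a ∈ ℤ/2nℤ`", (5.1), for
`ĥ = w_k^{(2q)} ∈ V_{2q} ∩ ℤ[ℤ/2nℤ]`, (5.3) and Prop. 3.2). [cite: Hazama2003CyclicCM, §5 (5.1)–(5.3) and Prop. 3.2] -/
theorem isBalanced_hazamaSet (hF : CyclicFrame p q ρ τ κ) (h : IsCMTypeWith ρ (Φ : Set G))
    (hr : haveI : NeZero p := ⟨hF.prime_left.ne_zero⟩; HasConstantRows p q Φ τ κ) (y₁ y₂ : ZMod q) :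
    haveI : NeZero p := ⟨hF.prime_left.ne_zero⟩
    IsBalanced G (Φ : Set G) (fun d => if d ∈ hazamaSet p ρ τ κ y₁ y₂ then (1 : ℚ) else 0) := by
  haveI : NeZero p := ⟨hF.prime_left.ne_zero⟩
  haveI : NeZero q := ⟨hF.prime_right.ne_zero⟩
  rw [isBalanced_indicator_iff, card_hazamaSet hF]
  intro g
  set c := rowCount p q Φ τ κ 0 with hc
  have hrow : ∀ y, rowCount p q Φ τ κ y = c := fun y => hr y 0
  have hcle : c ≤ p := rowCount_le p q Φ τ κ 0
  -- the translates of the two halves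
  have hmul : ∀ (a : ZMod p) (b : ZMod q) (x : ZMod p) (y : ZMod q),
      τ ^ a.val * κ ^ b.val * (τ ^ x.val * κ ^ y.val) = τ ^ (x + a).val * κ ^ (y + b).val := by
    intro a b x y
    rw [hF.tau_pow_val_add, hF.kappa_pow_val_add]
    simp only [mul_assoc, mul_comm, mul_left_comm]
  -- counting inside each half
  have hcount1 : ∀ (a : ZMod p) (b : ZMod q) (y : ZMod q),
      ((Finset.univ.image fun x : ZMod p => τ ^ x.val * κ ^ y.val).filter
        fun d => τ ^ a.val * κ ^ b.val * d ∈ Φ).card = c := by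
    intro a b y
    rw [Finset.filter_image, Finset.card_image_of_injective _ (pow_mul_pow_injective_left hF y)]
    simp_rw [hmul]
    rw [card_filter_add_eq inferInstance a (fun x : ZMod p => τ ^ x.val * κ ^ (y + b).val ∈ Φ)]
    exact hrow (y + b)
  have hcount2 : ∀ (a : ZMod p) (b : ZMod q) (y : ZMod q),
      ((Finset.univ.image fun x : ZMod p => τ ^ x.val * κ ^ y.val).filter
        fun d => ρ * (τ ^ a.val * κ ^ b.val) * d ∈ Φ).card = p - c := by
    intro a b y
    rw [Finset.filter_image, Finset.card_image_of_injective _ (pow_mul_pow_injective_left hF y)]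
    simp_rw [mul_assoc ρ, hmul, rho_mul_mem_iff h]
    rw [card_filter_add_eq inferInstance a (fun x : ZMod p => τ ^ x.val * κ ^ (y + b).val ∉ Φ),
      card_filter_not_mem_row inferInstance Φ τ κ (y + b), hrow]
  have hcount3 : ∀ (a : ZMod p) (b : ZMod q) (y : ZMod q),
      ((Finset.univ.image fun x : ZMod p => ρ * (τ ^ x.val * κ ^ y.val)).filter
        fun d => τ ^ a.val * κ ^ b.val * d ∈ Φ).card = p - c := by
    intro a b y
    rw [Finset.filter_image, Finset.card_image_of_injective _ (rho_mul_pow_mul_pow_injective_left hF y)]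
    simp_rw [mul_left_comm _ ρ, hmul, rho_mul_mem_iff h]
    rw [card_filter_add_eq inferInstance a (fun x : ZMod p => τ ^ x.val * κ ^ (y + b).val ∉ Φ),
      card_filter_not_mem_row inferInstance Φ τ κ (y + b), hrow]
  have hcount4 : ∀ (a : ZMod p) (b : ZMod q) (y : ZMod q),
      ((Finset.univ.image fun x : ZMod p => ρ * (τ ^ x.val * κ ^ y.val)).filter
        fun d => ρ * (τ ^ a.val * κ ^ b.val) * d ∈ Φ).card = c := by
    intro a b y
    rw [Finset.filter_image, Finset.card_image_of_injective _ (rho_mul_pow_mul_pow_injective_left hF y)]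
    have hρρ : ∀ x : ZMod p, ρ * (τ ^ a.val * κ ^ b.val) * (ρ * (τ ^ x.val * κ ^ y.val)) =
        τ ^ (x + a).val * κ ^ (y + b).val := fun x => by
      rw [← hmul]
      calc ρ * (τ ^ a.val * κ ^ b.val) * (ρ * (τ ^ x.val * κ ^ y.val))
          = ρ * ρ * (τ ^ a.val * κ ^ b.val * (τ ^ x.val * κ ^ y.val)) := by
            simp only [mul_assoc, mul_left_comm]
        _ = τ ^ a.val * κ ^ b.val * (τ ^ x.val * κ ^ y.val) := by rw [hF.rho_mul_rho, one_mul]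
    simp_rw [hρρ]
    rw [card_filter_add_eq inferInstance a (fun x : ZMod p => τ ^ x.val * κ ^ (y + b).val ∈ Φ)]
    exact hrow (y + b)
  obtain ⟨⟨a, b⟩, rfl | rfl⟩ := hF.exists_coord g
  · unfold hazamaSet
    rw [Finset.filter_union, Finset.card_union_of_disjoint
      ((disjoint_hazamaSet_parts hF y₁ y₂).mono (Finset.filter_subset _ _) (Finset.filter_subset _ _)),
      hcount1, hcount3]
    omega
  · unfold hazamaSet
    rw [Finset.filter_union, Finset.card_union_of_disjoint
      ((disjoint_hazamaSet_parts hF y₁ y₂).mono (Finset.filter_subset _ _) (Finset.filter_subset _ _)),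
      hcount2, hcount4]
    omega

/-- **`Δ(y₁, y₂)` is not a union of conjugate pairs when `y₁ ≠ y₂`** (height one: `Δ ∩ ρΔ = ∅`; here the witness
`κ^{y₁} ∈ Δ`, `ρκ^{y₁} ∉ Δ`). [cite: Hazama2003CyclicCM, §5 ("the height of them are equal to one")] -/
theorem exists_mem_hazamaSet_rho_mul_not_mem (hF : CyclicFrame p q ρ τ κ) {y₁ y₂ : ZMod q} (hy : y₁ ≠ y₂) :
    haveI : NeZero p := ⟨hF.prime_left.ne_zero⟩
    ∃ d ∈ hazamaSet p ρ τ κ y₁ y₂, ρ * d ∉ hazamaSet p ρ τ κ y₁ y₂ := by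
  haveI : NeZero p := ⟨hF.prime_left.ne_zero⟩
  refine ⟨τ ^ (0 : ZMod p).val * κ ^ y₁.val, ?_, ?_⟩
  · unfold hazamaSet
    exact Finset.mem_union_left _ (Finset.mem_image.2 ⟨0, Finset.mem_univ _, rfl⟩)
  · unfold hazamaSet
    rw [Finset.mem_union, not_or]
    constructor
    · intro hm
      obtain ⟨x, -, he⟩ := Finset.mem_image.1 hm
      exact hF.pow_mul_pow_ne_rho_mul _ _ _ _ he
    · intro hm
      obtain ⟨x, -, he⟩ := Finset.mem_image.1 hm
      have he' := hF.pow_mul_pow_injective (a₁ := (x, y₂)) (a₂ := (0, y₁)) (mul_left_cancel he)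
      exact hy (Prod.ext_iff.1 he').2.symm

/-- **Constant rows ⟹ DEGENERATE, by an explicit Pohlmann witness** (no characters): `Δ(0, 1)` is a balanced
set which is not `ρ`-symmetric, so `rank(S) < n + 1` by the tree's `symm_of_isBalanced_of_typeRank_eq`
(Pohlmann/White: nondegenerate types have only `ρ`-invariant balanced weights).
[cite: Hazama2003CyclicCM, Thm. 4.8 (ii) (`S_p ⊂ Deg`) and §5] -/
theorem typeRank_ne_of_hasConstantRows (hF : CyclicFrame p q ρ τ κ) (h : IsCMTypeWith ρ (Φ : Set G))
    (hr : haveI : NeZero p := ⟨hF.prime_left.ne_zero⟩; HasConstantRows p q Φ τ κ) :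
    typeRank G (Φ : Set G) ≠ Fintype.card G / 2 + 1 := by
  haveI : NeZero p := ⟨hF.prime_left.ne_zero⟩
  haveI : Fact (1 < q) := ⟨hF.prime_right.one_lt⟩
  intro hrank
  have hy : (0 : ZMod q) ≠ 1 := zero_ne_one
  obtain ⟨d, hd, hρd⟩ := exists_mem_hazamaSet_rho_mul_not_mem hF hy
  have hsym := h.symm_of_isBalanced_of_typeRank_eq hrank (isBalanced_hazamaSet hF h hr 0 1) d
  simp only [smul_eq_mul, if_pos hd, if_neg hρd] at hsym
  norm_num at hsym

/-- **`τ`-stable ⟹ DEGENERATE** (Kubota: a nondegenerate type is primitive; the translates of a `τ`-stable type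
do not separate `1` from `τ`). [cite: Hazama2003CyclicCM, Thm. 4.8 (ii)–(iii) (`S₁ ⊂ Deg`)] -/
theorem typeRank_ne_of_isStableUnder (hF : CyclicFrame p q ρ τ κ) (h : IsCMTypeWith ρ (Φ : Set G))
    {u : G} (hu1 : u ≠ 1) (hu : IsStableUnder Φ u) : typeRank G (Φ : Set G) ≠ Fintype.card G / 2 + 1 := by
  have _ := hF.card_eq
  intro hrank
  refine hu1 (h.eq_of_forall_smul_mem_iff_of_typeRank_eq hrank (x := 1) (y := u) fun g => ?_).symm
  rw [smul_eq_mul, smul_eq_mul, mul_one, Finset.mem_coe, Finset.mem_coe, hu g, mul_comm]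

/-- **Theorem 4.8 (ii): `Deg = S₁ ∪ S_p ∪ S_q`.**  A CM type of the cyclic group of order `2pq` is DEGENERATE
(`rank < pq + 1`) iff its rows have constant counts (`S_p`), or its columns do (`S_q`), or it is `τ`- or
`κ`-stable (`S₁ = Nonprim`).  Proof as printed: a degenerate type is killed by some odd character (Kubota,
Prop. 2.1), which has order `2` (impossible, Prop. 4.2), `2q` (Prop. 4.3), `2p` (Prop. 4.4) or `2pq`
(Lemma 4.6.1); the converse by explicit kernel elements (§5) and Prop. 2.3.
[cite: Hazama2003CyclicCM, Thm. 4.8 (ii)] -/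
theorem typeRank_ne_iff (hF : CyclicFrame p q ρ τ κ) (h : IsCMTypeWith ρ (Φ : Set G)) :
    haveI : NeZero p := ⟨hF.prime_left.ne_zero⟩
    haveI : NeZero q := ⟨hF.prime_right.ne_zero⟩
    typeRank G (Φ : Set G) ≠ p * q + 1 ↔
      HasConstantRows p q Φ τ κ ∨ HasConstantRows q p Φ κ τ ∨ IsStableUnder Φ τ ∨ IsStableUnder Φ κ := by
  haveI : NeZero p := ⟨hF.prime_left.ne_zero⟩
  haveI : NeZero q := ⟨hF.prime_right.ne_zero⟩
  have hcard : Fintype.card G / 2 + 1 = p * q + 1 := by rw [hF.card_eq, Nat.mul_div_cancel_left _ two_pos]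
  have hτ1 : τ ≠ 1 := fun e => by
    have := hF.orderOf_tau; rw [e, orderOf_one] at this; exact hF.prime_left.one_lt.ne this
  have hκ1 : κ ≠ 1 := fun e => by
    have := hF.orderOf_kappa; rw [e, orderOf_one] at this; exact hF.prime_right.one_lt.ne this
  constructor
  · intro hne
    rw [← hcard, ne_eq, h.typeRank_eq_iff_forall_oddCharacters] at hne
    push Not at hne
    obtain ⟨χ, hχ, hχ0⟩ := hne
    by_cases hτ : χ (Additive.ofMul τ) = 1 <;> by_cases hκ : χ (Additive.ofMul κ) = 1
    · exact absurd hχ0 (sum_char_ne_zero_of_trivial hF h χ hχ hτ hκ)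
    · exact Or.inl ((sum_char_eq_zero_iff_hasConstantRows hF h χ hχ hτ hκ).1 hχ0)
    · exact Or.inr (Or.inl ((sum_char_eq_zero_iff_hasConstantRows_swap hF h χ hχ hτ hκ).1 hχ0))
    · exact Or.inr (Or.inr ((sum_char_eq_zero_iff_isStableUnder hF h χ hχ hτ hκ).1 hχ0))
  · rw [← hcard]
    rintro (H | H | H | H)
    · exact typeRank_ne_of_hasConstantRows hF h H
    · exact typeRank_ne_of_hasConstantRows hF.swap h H
    · exact typeRank_ne_of_isStableUnder hF h hτ1 H
    · exact typeRank_ne_of_isStableUnder hF h hκ1 H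

/-- **Theorem 4.8 (ii), nondegenerate form**: `rank(S) = pq + 1` iff none of the four conditions holds.
[cite: Hazama2003CyclicCM, Thm. 4.8 (ii)] -/
theorem typeRank_eq_iff (hF : CyclicFrame p q ρ τ κ) (h : IsCMTypeWith ρ (Φ : Set G)) :
    haveI : NeZero p := ⟨hF.prime_left.ne_zero⟩
    haveI : NeZero q := ⟨hF.prime_right.ne_zero⟩
    typeRank G (Φ : Set G) = p * q + 1 ↔
      ¬ HasConstantRows p q Φ τ κ ∧ ¬ HasConstantRows q p Φ κ τ ∧ ¬ IsStableUnder Φ τ ∧ ¬ IsStableUnder Φ κ := by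
  have := typeRank_ne_iff hF h
  tauto

/-- **Theorem 4.8 (ii) + (iii) + Prop. 4.5: the PRIMITIVE DEGENERATE types are `(S_p − S₁) ⊔ (S_q − S₁)`.**  A
primitive (no non-trivial stabiliser) CM type of the cyclic group of order `2pq` is degenerate iff EXACTLY ONE of
"constant rows" / "constant columns" holds (both at once would force `S ∈ {S_even, S_odd}`, Prop. 4.5) — these
are Hazama's `p`-dominated, resp. `q`-dominated, primitive types. [cite: Hazama2003CyclicCM, Thm. 4.8 (ii)–(v) and Prop. 4.5] -/
theorem typeRank_ne_iff_of_primitive (hF : CyclicFrame p q ρ τ κ) (h : IsCMTypeWith ρ (Φ : Set G))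
    (hprim : ∀ u : G, u ≠ 1 → ¬ IsStableUnder Φ u) :
    haveI : NeZero p := ⟨hF.prime_left.ne_zero⟩
    haveI : NeZero q := ⟨hF.prime_right.ne_zero⟩
    typeRank G (Φ : Set G) ≠ p * q + 1 ↔
      (HasConstantRows p q Φ τ κ ∧ ¬ HasConstantRows q p Φ κ τ) ∨
        (HasConstantRows q p Φ κ τ ∧ ¬ HasConstantRows p q Φ τ κ) := by
  haveI : NeZero p := ⟨hF.prime_left.ne_zero⟩
  haveI : NeZero q := ⟨hF.prime_right.ne_zero⟩
  have hτ1 : τ ≠ 1 := fun e => by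
    have := hF.orderOf_tau; rw [e, orderOf_one] at this; exact hF.prime_left.one_lt.ne this
  have hκ1 : κ ≠ 1 := fun e => by
    have := hF.orderOf_kappa; rw [e, orderOf_one] at this; exact hF.prime_right.one_lt.ne this
  have hboth : ¬ (HasConstantRows p q Φ τ κ ∧ HasConstantRows q p Φ κ τ) := fun hb =>
    hprim τ hτ1 (isStableUnder_and_of_hasConstantRows hF h hb.1 hb.2).1
  rw [typeRank_ne_iff hF h]
  have hτ' := hprim τ hτ1
  have hκ' := hprim κ hκ1
  tauto

end Balanced

/-! ## §6 Primitive degenerate types exist in every frame (Rem. 4.9 at group level) -/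

section Existence

variable {G : Type*} [CommGroup G] [Fintype G] [DecidableEq G] {p q : ℕ} {ρ τ κ : G}

/-- **Hazama's example matrix `(a_{ij})`, `a_{i1} = 1`, `a_{ij} = 0` (`j ≥ 2`)**, as a CM type of the frame: one
element `τ^{sel(y)} κʸ` of each row lies in the type (`sel(0) = 1`, `sel(y) = 0` otherwise), the other elements of
the odd part enter through their conjugates. [cite: Hazama2003CyclicCM, §6 (the matrix `(a_{ij}) ∈ M(5,3)`)] -/
def exampleType (p q : ℕ) [NeZero p] [NeZero q] (ρ τ κ : G) : Finset G :=
  Finset.univ.image fun xy : ZMod p × ZMod q =>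
    if xy.1 = (if xy.2 = 0 then 1 else 0) then τ ^ xy.1.val * κ ^ xy.2.val
    else ρ * (τ ^ xy.1.val * κ ^ xy.2.val)

/-- Membership of the odd part in the example type: `τˣκʸ ∈ S ↔ x = sel(y)`. [cite: Hazama2003CyclicCM, §6] -/
theorem pow_mul_pow_mem_exampleType_iff (hF : CyclicFrame p q ρ τ κ) (x : ZMod p) (y : ZMod q) :
    haveI : NeZero p := ⟨hF.prime_left.ne_zero⟩
    haveI : NeZero q := ⟨hF.prime_right.ne_zero⟩
    τ ^ x.val * κ ^ y.val ∈ exampleType p q ρ τ κ ↔ x = if y = 0 then 1 else 0 := by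
  haveI : NeZero p := ⟨hF.prime_left.ne_zero⟩
  haveI : NeZero q := ⟨hF.prime_right.ne_zero⟩
  unfold exampleType
  rw [Finset.mem_image]
  constructor
  · rintro ⟨⟨x', y'⟩, -, h⟩
    by_cases hsel : x' = if y' = 0 then 1 else 0
    · rw [if_pos hsel] at h
      have := hF.pow_mul_pow_injective (a₁ := (x', y')) (a₂ := (x, y)) h
      rw [Prod.ext_iff] at this
      obtain ⟨rfl, rfl⟩ := this
      exact hsel
    · rw [if_neg hsel] at h
      exact absurd h.symm (hF.pow_mul_pow_ne_rho_mul _ _ _ _)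
  · intro hx
    exact ⟨(x, y), Finset.mem_univ _, by simp only [if_pos hx]⟩

/-- Membership of the conjugate odd part in the example type: `ρτˣκʸ ∈ S ↔ x ≠ sel(y)`. [cite: Hazama2003CyclicCM, §6] -/
theorem rho_mul_mem_exampleType_iff (hF : CyclicFrame p q ρ τ κ) (x : ZMod p) (y : ZMod q) :
    haveI : NeZero p := ⟨hF.prime_left.ne_zero⟩
    haveI : NeZero q := ⟨hF.prime_right.ne_zero⟩
    ρ * (τ ^ x.val * κ ^ y.val) ∈ exampleType p q ρ τ κ ↔ x ≠ if y = 0 then 1 else 0 := by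
  haveI : NeZero p := ⟨hF.prime_left.ne_zero⟩
  haveI : NeZero q := ⟨hF.prime_right.ne_zero⟩
  unfold exampleType
  rw [Finset.mem_image]
  constructor
  · rintro ⟨⟨x', y'⟩, -, h⟩
    by_cases hsel : x' = if y' = 0 then 1 else 0
    · rw [if_pos hsel] at h
      exact absurd h (hF.pow_mul_pow_ne_rho_mul _ _ _ _)
    · rw [if_neg hsel] at h
      have := hF.pow_mul_pow_injective (a₁ := (x', y')) (a₂ := (x, y)) (mul_left_cancel h)
      rw [Prod.ext_iff] at this
      obtain ⟨rfl, rfl⟩ := this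
      exact hsel
  · intro hx
    exact ⟨(x, y), Finset.mem_univ _, by simp only [if_neg hx]⟩

/-- The example type is a CM type for `ρ`. [cite: Hazama2003CyclicCM, §6] -/
theorem isCMTypeWith_exampleType (hF : CyclicFrame p q ρ τ κ) :
    haveI : NeZero p := ⟨hF.prime_left.ne_zero⟩
    haveI : NeZero q := ⟨hF.prime_right.ne_zero⟩
    IsCMTypeWith ρ (exampleType p q ρ τ κ : Set G) := by
  haveI : NeZero p := ⟨hF.prime_left.ne_zero⟩
  haveI : NeZero q := ⟨hF.prime_right.ne_zero⟩
  refine ⟨fun g => ?_, fun g x => ?_, fun x => ?_⟩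
  · obtain ⟨⟨x, y⟩, rfl | rfl⟩ := hF.exists_coord g
    · rw [Finset.mem_coe, smul_eq_mul, Finset.mem_coe, pow_mul_pow_mem_exampleType_iff hF,
        rho_mul_mem_exampleType_iff hF, not_not]
    · rw [Finset.mem_coe, smul_eq_mul, Finset.mem_coe,
        show ρ * (ρ * (τ ^ x.val * κ ^ y.val)) = τ ^ x.val * κ ^ y.val by
          rw [← mul_assoc, hF.rho_mul_rho, one_mul],
        pow_mul_pow_mem_exampleType_iff hF, rho_mul_mem_exampleType_iff hF]
  · change g * (ρ * x) = ρ * (g * x)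
    rw [mul_left_comm]
  · change ρ * (ρ * x) = x
    rw [← mul_assoc, hF.rho_mul_rho, one_mul]

/-- The example type has constant row counts (`= 1`: "`a_{i1} = 1`, `a_{ij} = 0` for `j ≥ 2`").
[cite: Hazama2003CyclicCM, §6] -/
theorem rowCount_exampleType (hF : CyclicFrame p q ρ τ κ) (y : ZMod q) :
    haveI : NeZero p := ⟨hF.prime_left.ne_zero⟩
    haveI : NeZero q := ⟨hF.prime_right.ne_zero⟩
    rowCount p q (exampleType p q ρ τ κ) τ κ y = 1 := by
  haveI : NeZero p := ⟨hF.prime_left.ne_zero⟩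
  haveI : NeZero q := ⟨hF.prime_right.ne_zero⟩
  unfold rowCount
  rw [Finset.card_eq_one]
  refine ⟨if y = 0 then 1 else 0, Finset.ext fun x => ?_⟩
  rw [Finset.mem_filter, Finset.mem_singleton, pow_mul_pow_mem_exampleType_iff hF]
  simp

/-- **Rem. 4.9 at group level: every cyclic group of order `2pq` carries a PRIMITIVE CM type with constant row
counts** (a `p`-dominated primitive type; with the roles exchanged, a `q`-dominated one): the example type is
not stable under any `u ≠ 1` and its rows have one element each.  ("our theorem for `p = 3` gives a constructive
version … there is always a degenerate CM-type for `ℚ(ζ_{2n+1})` whenever `n` is the product of three and an odd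
prime `> 3`"; §6 "satisfies the condition specified in Proposition 4.3".) [cite: Hazama2003CyclicCM, Rem. 4.9 and §6] -/
theorem exists_primitive_hasConstantRows (hF : CyclicFrame p q ρ τ κ) :
    haveI : NeZero p := ⟨hF.prime_left.ne_zero⟩
    ∃ Φ : Finset G, IsCMTypeWith ρ (Φ : Set G) ∧ HasConstantRows p q Φ τ κ ∧
      ∀ u : G, u ≠ 1 → ¬ IsStableUnder Φ u := by
  haveI : NeZero p := ⟨hF.prime_left.ne_zero⟩
  haveI : NeZero q := ⟨hF.prime_right.ne_zero⟩
  haveI : Fact (1 < p) := ⟨hF.prime_left.one_lt⟩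
  haveI : Fact (1 < q) := ⟨hF.prime_right.one_lt⟩
  have h := isCMTypeWith_exampleType hF
  refine ⟨exampleType p q ρ τ κ, h, fun y y' => by rw [rowCount_exampleType hF, rowCount_exampleType hF], ?_⟩
  -- no non-trivial stabiliser: neither `τ` nor `κ` stabilises the example type
  have hε : ∀ (x : ZMod p) (y : ZMod q), signMatrix p q (exampleType p q ρ τ κ) τ κ (x, y) = 1 ↔
      x = if y = 0 then 1 else 0 := fun x y => by
    rw [signMatrix_eq_one_iff]; exact pow_mul_pow_mem_exampleType_iff hF x y
  have hnotτ : ¬ IsStableUnder (exampleType p q ρ τ κ) τ := by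
    rw [← forall_signMatrix_eq_left_iff hF h]
    intro H
    have h1 : signMatrix p q (exampleType p q ρ τ κ) τ κ (1, 0) = 1 := (hε 1 0).2 (by simp)
    have h2 := H (1 + 1) 1 (0 : ZMod q)
    rw [h1, hε] at h2
    simp only [if_true] at h2
    exact one_ne_zero (add_eq_right.1 h2)
  have hnotκ : ¬ IsStableUnder (exampleType p q ρ τ κ) κ := by
    rw [← forall_signMatrix_eq_right_iff hF h]
    intro H
    have h1 : signMatrix p q (exampleType p q ρ τ κ) τ κ (1, 0) = 1 := (hε 1 0).2 (by simp)
    have h2 := H 1 (1 : ZMod q) 0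
    rw [h1, hε, if_neg one_ne_zero] at h2
    exact one_ne_zero h2
  intro u hu hstab
  rcases (exists_isStableUnder_iff hF h).1 ⟨u, hu, hstab⟩ with H | H
  · exact hnotτ H
  · exact hnotκ H

/-- **Rem. 4.9 / Thm. 4.8 (iv): primitive DEGENERATE types exist on every cyclic group of order `2pq`** — in Kubota's
language: a CM type of rank `< pq + 1` whose translates separate points. [cite: Hazama2003CyclicCM, Rem. 4.9 and Thm. 4.8 (iv)] -/
theorem exists_primitive_typeRank_ne (hF : CyclicFrame p q ρ τ κ) :
    ∃ Φ : Finset G, IsCMTypeWith ρ (Φ : Set G) ∧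
      (∀ x y : G, (∀ g : G, g • x ∈ (Φ : Set G) ↔ g • y ∈ (Φ : Set G)) → x = y) ∧
      typeRank G (Φ : Set G) ≠ p * q + 1 := by
  obtain ⟨Φ, h, hr, hprim⟩ := exists_primitive_hasConstantRows hF
  refine ⟨Φ, h, ?_, (typeRank_ne_iff hF h).2 (Or.inl hr)⟩
  by_contra hsep
  obtain ⟨u, hu1, hu⟩ := (exists_isStableUnder_iff_not_separating Φ).2 hsep
  exact hprim u hu1 hu

end Existence

/-! ## §7 The exact rank: counting the vanishing odd characters (Prop. 2.1 with Theorem 4.8) -/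

section Rank

variable {G : Type*} [CommGroup G] [Fintype G] [DecidableEq G] {p q : ℕ} {ρ τ κ : G} {Φ : Finset G}

open Literature.AlgebraicGeometry.Pohlmann1968 (two_mul_ncard_oddCharacters_eq_card)

omit [DecidableEq G] in
/-- An odd character of `⟨ρ⟩ × ⟨τ⟩ × ⟨κ⟩` is determined by `(χ(τ), χ(κ))`. [cite: Hazama2003CyclicCM, §3 (the characters `χ_i` of `ℤ/2nℤ`)] -/
theorem oddChar_injOn (hF : CyclicFrame p q ρ τ κ) :
    Set.InjOn (fun χ : AddChar (Additive G) ℂ => (χ (Additive.ofMul τ), χ (Additive.ofMul κ)))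
      {χ : AddChar (Additive G) ℂ | χ (Additive.ofMul ρ) = -1} := by
  intro χ₁ h₁ χ₂ h₂ heq
  simp only [Set.mem_setOf_eq, Prod.mk.injEq] at h₁ h₂ heq
  refine DFunLike.ext _ _ fun a => ?_
  obtain ⟨⟨x, y⟩, hx | hx⟩ := hF.exists_coord (Additive.toMul a)
  · have : a = Additive.ofMul (τ ^ x.val * κ ^ y.val) := by rw [← hx]; rfl
    rw [this, char_mul, char_mul, char_pow, char_pow, char_pow, char_pow, heq.1, heq.2]
  · have : a = Additive.ofMul (ρ * (τ ^ x.val * κ ^ y.val)) := by rw [← hx]; rfl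
    rw [this, char_mul, char_mul, char_mul, char_mul, char_pow, char_pow, char_pow, char_pow, h₁, h₂, heq.1,
      heq.2]

/-- The pairs `(α, β)` of a `p`-th and a `q`-th root of unity, as a finset. [folklore] -/
private theorem coe_nthRootsFinset_prod (hp : 0 < p) (hq : 0 < q) :
    {ab : ℂ × ℂ | ab.1 ^ p = 1 ∧ ab.2 ^ q = 1} =
      ↑(Polynomial.nthRootsFinset p (1 : ℂ) ×ˢ Polynomial.nthRootsFinset q (1 : ℂ)) := by
  ext ⟨a, b⟩
  rw [Set.mem_setOf_eq, Finset.coe_product, Set.mem_prod, Finset.mem_coe, Finset.mem_coe,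
    Polynomial.mem_nthRootsFinset hp, Polynomial.mem_nthRootsFinset hq]

omit [DecidableEq G] in
/-- **The odd characters of `⟨ρ⟩ × ⟨τ⟩ × ⟨κ⟩` correspond bijectively to the pairs `(α, β) ∈ μ_p × μ_q`** via
`χ ↦ (χ(τ), χ(κ))` (there are `pq` of each). [cite: Hazama2003CyclicCM, §3 (`X⁻(ℤ/2nℤ)` consists of `n` characters)] -/
theorem image_oddChar_eq (hF : CyclicFrame p q ρ τ κ) :
    (fun χ : AddChar (Additive G) ℂ => (χ (Additive.ofMul τ), χ (Additive.ofMul κ))) ''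
        {χ : AddChar (Additive G) ℂ | χ (Additive.ofMul ρ) = -1} =
      {ab : ℂ × ℂ | ab.1 ^ p = 1 ∧ ab.2 ^ q = 1} := by
  have hp := hF.prime_left.pos
  have hq := hF.prime_right.pos
  apply Set.eq_of_subset_of_ncard_le
  · rintro _ ⟨χ, -, rfl⟩
    exact ⟨by rw [← char_pow, hF.tau_pow, ofMul_one, AddChar.map_zero_eq_one],
      by rw [← char_pow, hF.kappa_pow, ofMul_one, AddChar.map_zero_eq_one]⟩
  · rw [(oddChar_injOn hF).ncard_image, coe_nthRootsFinset_prod hp hq, Set.ncard_coe_finset,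
      Finset.card_product, (Complex.isPrimitiveRoot_exp p hp.ne').card_nthRootsFinset,
      (Complex.isPrimitiveRoot_exp q hq.ne').card_nthRootsFinset]
    have h2 := two_mul_ncard_oddCharacters_eq_card (G := G) hF.rho_ne_one hF.rho_mul_rho
    rw [hF.card_eq] at h2
    omega
  · rw [coe_nthRootsFinset_prod hp hq]
    exact Finset.finite_toSet _

open scoped Classical in
/-- **The number of odd characters vanishing on `S`** (the `q − 1` characters of order `2q` if the rows are
constant, the `p − 1` of order `2p` if the columns are, the `(p−1)(q−1)` faithful ones if `S` is not primitive):
Theorem 4.8 read through Prop. 2.1. [cite: Hazama2003CyclicCM, Thm. 4.8 and Prop. 2.1] -/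
theorem ncard_oddChar_vanishing_eq (hF : CyclicFrame p q ρ τ κ) (h : IsCMTypeWith ρ (Φ : Set G)) :
    haveI : NeZero p := ⟨hF.prime_left.ne_zero⟩
    haveI : NeZero q := ⟨hF.prime_right.ne_zero⟩
    {χ : AddChar (Additive G) ℂ | χ (Additive.ofMul ρ) = -1 ∧ ∑ s ∈ Φ, χ (Additive.ofMul s) = 0}.ncard =
      (if HasConstantRows p q Φ τ κ then q - 1 else 0) + (if HasConstantRows q p Φ κ τ then p - 1 else 0) +
        (if IsStableUnder Φ τ ∨ IsStableUnder Φ κ then (p - 1) * (q - 1) else 0) := by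
  haveI : NeZero p := ⟨hF.prime_left.ne_zero⟩
  haveI : NeZero q := ⟨hF.prime_right.ne_zero⟩
  have hp := hF.prime_left.pos
  have hq := hF.prime_right.pos
  set Rows := HasConstantRows p q Φ τ κ with hRows
  set Cols := HasConstantRows q p Φ κ τ with hCols
  set Stab := IsStableUnder Φ τ ∨ IsStableUnder Φ κ with hStab
  set ev : AddChar (Additive G) ℂ → ℂ × ℂ := fun χ => (χ (Additive.ofMul τ), χ (Additive.ofMul κ)) with hev
  set C : Set (ℂ × ℂ) := {ab | (ab.1 = 1 ∧ ab.2 ≠ 1 ∧ Rows) ∨ (ab.1 ≠ 1 ∧ ab.2 = 1 ∧ Cols) ∨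
    (ab.1 ≠ 1 ∧ ab.2 ≠ 1 ∧ Stab)} with hC
  -- the vanishing odd characters are the odd characters whose `(χ τ, χ κ)` lies in `C`
  have hV : {χ : AddChar (Additive G) ℂ | χ (Additive.ofMul ρ) = -1 ∧ ∑ s ∈ Φ, χ (Additive.ofMul s) = 0} =
      {χ : AddChar (Additive G) ℂ | χ (Additive.ofMul ρ) = -1} ∩ ev ⁻¹' C := by
    ext χ
    simp only [Set.mem_setOf_eq, Set.mem_inter_iff, Set.mem_preimage, hev, hC]
    refine and_congr_right fun hχ => ?_
    by_cases hτ : χ (Additive.ofMul τ) = 1 <;> by_cases hκ : χ (Additive.ofMul κ) = 1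
    · simp only [hτ, hκ, ne_eq, not_true_eq_false, and_false, false_and, or_self, iff_false]
      exact sum_char_ne_zero_of_trivial hF h χ hχ hτ hκ
    · rw [sum_char_eq_zero_iff_hasConstantRows hF h χ hχ hτ hκ]
      simp only [hτ, hκ, ne_eq, not_true_eq_false, not_false_eq_true, true_and, false_and, or_false]
      exact Iff.rfl
    · rw [sum_char_eq_zero_iff_hasConstantRows_swap hF h χ hχ hτ hκ]
      simp only [hτ, hκ, ne_eq, not_true_eq_false, not_false_eq_true, true_and, false_and, and_false,
        or_false, false_or]
      exact Iff.rfl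
    · rw [sum_char_eq_zero_iff_isStableUnder hF h χ hχ hτ hκ]
      simp only [hτ, hκ, ne_eq, not_false_eq_true, true_and, false_and, false_or]
      exact Iff.rfl
  have hinj : Set.InjOn ev ({χ : AddChar (Additive G) ℂ | χ (Additive.ofMul ρ) = -1} ∩ ev ⁻¹' C) :=
    (oddChar_injOn hF).mono Set.inter_subset_left
  rw [hV, ← hinj.ncard_image, Set.image_inter_preimage, hev, image_oddChar_eq hF]
  -- count inside `μ_p × μ_q`
  set Rp := Polynomial.nthRootsFinset p (1 : ℂ) with hRp
  set Rq := Polynomial.nthRootsFinset q (1 : ℂ) with hRq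
  have h1p : (1 : ℂ) ∈ Rp := (Polynomial.mem_nthRootsFinset hp (1 : ℂ)).2 (one_pow p)
  have h1q : (1 : ℂ) ∈ Rq := (Polynomial.mem_nthRootsFinset hq (1 : ℂ)).2 (one_pow q)
  have hcp : Rp.card = p := (Complex.isPrimitiveRoot_exp p hp.ne').card_nthRootsFinset
  have hcq : Rq.card = q := (Complex.isPrimitiveRoot_exp q hq.ne').card_nthRootsFinset
  set W : Finset (ℂ × ℂ) := ((if Rows then {(1 : ℂ)} ×ˢ Rq.erase 1 else ∅) ∪
    (if Cols then Rp.erase 1 ×ˢ {(1 : ℂ)} else ∅)) ∪ (if Stab then Rp.erase 1 ×ˢ Rq.erase 1 else ∅) with hW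
  have hset : {ab : ℂ × ℂ | ab.1 ^ p = 1 ∧ ab.2 ^ q = 1} ∩ C = ↑W := by
    ext ⟨a, b⟩
    simp only [Set.mem_inter_iff, Set.mem_setOf_eq, hC, hW, Finset.coe_union, Set.mem_union, Finset.mem_coe]
    rw [← Polynomial.mem_nthRootsFinset hp (a := (1 : ℂ)), ← Polynomial.mem_nthRootsFinset hq (a := (1 : ℂ))]
    by_cases hr : Rows <;> by_cases hc : Cols <;> by_cases hs : Stab <;>
      simp only [hr, hc, hs, if_true, if_false, Finset.mem_product, Finset.mem_singleton, Finset.mem_erase,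
        Finset.notMem_empty, and_true, and_false, or_false, false_or, ne_eq] <;>
      constructor <;> intro H <;>
      (try (rcases H with ⟨⟨ha, hb⟩, H⟩)) <;>
      aesop
  have hdisj1 : Disjoint (if Rows then ({(1 : ℂ)} ×ˢ Rq.erase 1 : Finset (ℂ × ℂ)) else ∅)
      (if Cols then Rp.erase 1 ×ˢ {(1 : ℂ)} else ∅) := by
    split_ifs
    · rw [Finset.disjoint_left]
      rintro ⟨a, b⟩ h1 h2
      rw [Finset.mem_product, Finset.mem_singleton] at h1
      rw [Finset.mem_product, Finset.mem_erase] at h2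
      exact h2.1.1 h1.1
    · exact Finset.disjoint_empty_right _
    · exact Finset.disjoint_empty_left _
    · exact Finset.disjoint_empty_left _
  have hdisj2 : Disjoint ((if Rows then ({(1 : ℂ)} ×ˢ Rq.erase 1 : Finset (ℂ × ℂ)) else ∅) ∪
      (if Cols then Rp.erase 1 ×ˢ {(1 : ℂ)} else ∅)) (if Stab then Rp.erase 1 ×ˢ Rq.erase 1 else ∅) := by
    rw [Finset.disjoint_union_left]
    constructor
    · split_ifs
      · rw [Finset.disjoint_left]
        rintro ⟨a, b⟩ h1 h2
        rw [Finset.mem_product, Finset.mem_singleton] at h1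
        rw [Finset.mem_product, Finset.mem_erase] at h2
        exact h2.1.1 h1.1
      · exact Finset.disjoint_empty_right _
      · exact Finset.disjoint_empty_left _
      · exact Finset.disjoint_empty_left _
    · split_ifs
      · rw [Finset.disjoint_left]
        rintro ⟨a, b⟩ h1 h2
        rw [Finset.mem_product, Finset.mem_singleton] at h1
        rw [Finset.mem_product, Finset.mem_erase, Finset.mem_erase] at h2
        exact h2.2.1 h1.2
      · exact Finset.disjoint_empty_right _
      · exact Finset.disjoint_empty_left _
      · exact Finset.disjoint_empty_left _
  rw [hset, Set.ncard_coe_finset, hW, Finset.card_union_of_disjoint hdisj2,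
    Finset.card_union_of_disjoint hdisj1]
  have e1 : (if Rows then ({(1 : ℂ)} ×ˢ Rq.erase 1 : Finset (ℂ × ℂ)) else ∅).card = if Rows then q - 1 else 0 := by
    split_ifs
    · rw [Finset.card_product, Finset.card_singleton, Finset.card_erase_of_mem h1q, hcq, one_mul]
    · rfl
  have e2 : (if Cols then (Rp.erase 1 ×ˢ {(1 : ℂ)} : Finset (ℂ × ℂ)) else ∅).card = if Cols then p - 1 else 0 := by
    split_ifs
    · rw [Finset.card_product, Finset.card_singleton, Finset.card_erase_of_mem h1p, hcp, mul_one]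
    · rfl
  have e3 : (if Stab then (Rp.erase 1 ×ˢ Rq.erase 1 : Finset (ℂ × ℂ)) else ∅).card =
      if Stab then (p - 1) * (q - 1) else 0 := by
    split_ifs
    · rw [Finset.card_product, Finset.card_erase_of_mem h1p, Finset.card_erase_of_mem h1q, hcp, hcq]
    · rfl
  rw [e1, e2, e3]

open scoped Classical in
/-- **The rank of a CM type of the cyclic group of order `2pq`** (Kubota's `rank = pq + 1 − defect`, Prop. 2.1,
with the defect counted by Theorem 4.8): `rank(S) + (q−1)[S ∈ S_p] + (p−1)[S ∈ S_q] + (p−1)(q−1)[S ∈ S₁] = pq + 1`.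
[cite: Hazama2003CyclicCM, Prop. 2.1 and Thm. 4.8] [cite: Kubota1965, §4 Lemma 2] -/
theorem typeRank_add_defect_eq (hF : CyclicFrame p q ρ τ κ) (h : IsCMTypeWith ρ (Φ : Set G)) :
    haveI : NeZero p := ⟨hF.prime_left.ne_zero⟩
    haveI : NeZero q := ⟨hF.prime_right.ne_zero⟩
    typeRank G (Φ : Set G) +
        ((if HasConstantRows p q Φ τ κ then q - 1 else 0) + (if HasConstantRows q p Φ κ τ then p - 1 else 0) +
          (if IsStableUnder Φ τ ∨ IsStableUnder Φ κ then (p - 1) * (q - 1) else 0)) = p * q + 1 := by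
  haveI : NeZero p := ⟨hF.prime_left.ne_zero⟩
  haveI : NeZero q := ⟨hF.prime_right.ne_zero⟩
  have hdef := h.typeRank_add_ncard_oddCharacters_vanishing
  rw [ncard_oddChar_vanishing_eq hF h] at hdef
  have hodd := two_mul_ncard_oddCharacters_eq_card (G := G) hF.rho_ne_one hF.rho_mul_rho
  rw [hF.card_eq] at hodd
  have : {χ : AddChar (Additive G) ℂ | χ (Additive.ofMul ρ) = -1}.ncard = p * q := by omega
  rw [this] at hdef
  convert hdef using 2

/-- **The rank of a primitive `p`-dominated type** (`S ∈ S_p − S₁`: primitive with constant row counts):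
`rank(S) = pq + 1 − (q − 1) = (p−1)q + 2` — the `q − 1` odd characters of order `2q` are exactly the vanishing ones
(§5: "`K_S`" is `V_{2q} ∩ ℤ[ℤ/2nℤ]`, of rank `q − 1`), so `dim Hg(A_S) = rank(S) − 1 = pq − q + 1 < pq = dim A_S`.
[cite: Hazama2003CyclicCM, Thm. 4.8 (iv) and §5 (5.3)] -/
theorem typeRank_eq_of_primitive_of_hasConstantRows (hF : CyclicFrame p q ρ τ κ)
    (h : IsCMTypeWith ρ (Φ : Set G)) (hprim : ∀ u : G, u ≠ 1 → ¬ IsStableUnder Φ u)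
    (hr : haveI : NeZero p := ⟨hF.prime_left.ne_zero⟩; HasConstantRows p q Φ τ κ) :
    typeRank G (Φ : Set G) = (p - 1) * q + 2 := by
  classical
  haveI : NeZero p := ⟨hF.prime_left.ne_zero⟩
  haveI : NeZero q := ⟨hF.prime_right.ne_zero⟩
  have hτ1 : τ ≠ 1 := fun e => by
    have := hF.orderOf_tau; rw [e, orderOf_one] at this; exact hF.prime_left.one_lt.ne this
  have hκ1 : κ ≠ 1 := fun e => by
    have := hF.orderOf_kappa; rw [e, orderOf_one] at this; exact hF.prime_right.one_lt.ne this
  have hstab : ¬ (IsStableUnder Φ τ ∨ IsStableUnder Φ κ) := by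
    rintro (H | H)
    · exact hprim τ hτ1 H
    · exact hprim κ hκ1 H
  have hcols : ¬ HasConstantRows q p Φ κ τ := fun hc =>
    hprim τ hτ1 (isStableUnder_and_of_hasConstantRows hF h hr hc).1
  have key := typeRank_add_defect_eq hF h
  rw [if_pos hr, if_neg hcols, if_neg hstab, add_zero, add_zero] at key
  have hp1 := hF.prime_left.one_lt
  have hq1 := hF.prime_right.one_lt
  have e : (p - 1) * q + 2 + (q - 1) = p * q + 1 := by
    zify [hp1.le, hq1.le]
    ring
  omega

/-- **The rank of a primitive `q`-dominated type** (`S ∈ S_q − S₁`): `rank(S) = (q−1)p + 2`.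
[cite: Hazama2003CyclicCM, Thm. 4.8 (v) and §5] -/
theorem typeRank_eq_of_primitive_of_hasConstantRows_swap (hF : CyclicFrame p q ρ τ κ)
    (h : IsCMTypeWith ρ (Φ : Set G)) (hprim : ∀ u : G, u ≠ 1 → ¬ IsStableUnder Φ u)
    (hc : haveI : NeZero q := ⟨hF.prime_right.ne_zero⟩; HasConstantRows q p Φ κ τ) :
    typeRank G (Φ : Set G) = (q - 1) * p + 2 :=
  typeRank_eq_of_primitive_of_hasConstantRows hF.swap h hprim hc

end Rank

end CyclicCMType

end Literature.NumberTheory.ComplexMultiplication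

end
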